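import Literature.Probability.LatticeModels.MultiPairLocalizedSwitching
import Literature.Probability.LatticeModels.IntersectionClusteringInduction
import Literature.Probability.LatticeModels.CurrentsPartialMonotonicity
import HarnessLib

/-!
# The core of the mixing property of random currents (Aizenman–Duminil-Copin 2021, Thm 6.4): from the concentration of `𝐍` and the split events to the approximate factorisation (6.16)

Topic `Literature/Probability/LatticeModels`. Theorems and auxiliary definitions only: **no named fact is
introduced** (D-0026).

M. Aizenman, H. Duminil-Copin, *Marginal triviality of the scaling limits of critical 4D Ising and `φ⁴₄`
models*, Ann. of Math. **194** (2021) = arXiv:1912.07973, **§6.2** (pp. 23–26), proof of **Theorem 6.4**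
(random currents' mixing property); R. Panis, arXiv:2309.05797, §6.4 (Thm 6.20, Lemmas 6.21, 6.23). The
proof introduces a non-negative random variable `𝐍 = ∏ᵢ 𝐍ᵢ` on `s` currents coupled to `s` auxiliary
sourceless currents,

  "`𝐍ᵢ := (1/|𝒦|) ∑_{k ∈ 𝒦} (1/A_{x_i,y_i}(2^k)) ∑_{u ∈ 𝔸_{y_i}(2^k)} 𝕀[u ↔ x_i in n_i + n'_i]`,
  `a_{x,y}(u) := ⟨σ_xσ_u⟩⟨σ_uσ_y⟩/⟨σ_xσ_y⟩`, `A_{x,y}(m) := ∑_{u ∈ 𝔸_y(m)} a_{x,y}(u)`" (p. 23),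

with `E[𝐍] = 1` (switching lemma), and derives the approximate factorisation

  (6.16) "`|P^{xy}[E ∩ F] - ∑_u δ(u,x,y) P^{xu}[E] P^{uy}[F]| ≤ C₅s/√log(N/n) + 2C₆s(n/N)^ε`"

from three inputs: the **concentration** `E[(𝐍-1)²] ≤ C₀/log(N/n)` (Prop. 6.6, whose proof reduces to
the two-site bounds (6.5) "`∑_{u ∈ 𝔸(2^k), v ∈ 𝔸(2^ℓ)} P^{xy,∅}[u,v ↔ x] ≤ A(2^k)A(2^ℓ)(1 + C₃2^{-(ℓ-k)})`"),
the **localized switching** (6.14) and the **bound on the split events** (Lemma 6.7,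
"`P^{xu,uy}[G(u₁,…,u_t)ᶜ] ≤ s(n/N)^ε`").

This file proves that derivation ON A FINITE GRAPH, in un-normalised current-sum form, for the case
needed by the tree's `improvedTreeDiagramBound_of_intersection_and_mixing` (`s = 4` currents, `t = 2`
of them sourced): the measure `P^{x₁y₁, x₂y₂, ∅, ∅}` realised as two independent double currents
(`Current.FourCfg`, sourced current second in each pair, `Current.srcWeight K A₁ A₂`), coupled to four
auxiliary sourceless currents (`Current.OctoCfg = Fin 4 → Current G × Current G`, pairs
`(n_i, n'_i)`). The two-site bounds (6.5) and the split-event bound enter as HYPOTHESES (`hB`, `hG`) —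
they are the business of the regularity estimates (§5) and of Lemma 6.7 respectively:

* Part 1 — the eight currents: weights, the projections to the unprimed/primed four currents, Fubini;
* Part 2 — `𝐍`: `Current.nVar`, its mean `E[𝐍ᵢ] = 1` (`tsum_srcPairWeight_mul_nPair`, from the three-point
  identity) and second moment from (6.5) (`tsum_srcPairWeight_mul_nPair_sq_le`, through Prop. A.3);
* Part 3 — the weighted Cauchy–Schwarz inequality in `ℝ≥0∞` and
  "`|P[E∩F] - E[𝐍 𝕀_{E∩F}]| ≤ √E[(𝐍-1)²]`";
* Part 4 — the switching step ((6.14) via `Current.tsum_multiPair_switch_local`, (6.15), Lemma 6.7 as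
  hypothesis) and **the main theorem `Current.mixingCore`** = (6.16) in two one-sided un-normalised
  forms.

## References

* M. Aizenman, H. Duminil-Copin, Ann. of Math. 194 (2021), arXiv:1912.07973, §6.2: definition of `𝐍`
  (p. 23), Prop. 6.6 and (6.5) (pp. 23–24), (6.14)–(6.16), Lemma 6.7 (pp. 24–25) [AizenmanDuminilCopinAnnals2021].
* R. Panis, arXiv:2309.05797 (2023), §6.4: Thm 6.20, Lemma 6.21, Def. 6.22, Lemma 6.23
  [Panis2023Triviality].

## Mathlib

`ENNReal.tsum_prod'`, `ENNReal.tsum_comm`, `ENNReal.tsum_mul_left`, `Equiv.tsum_eq`, `Fin.consEquiv`,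
`Finset.sum_mul_sum`, `ENNReal.mul_inv_cancel`.
-/

noncomputable section

open Finset Filter
open scoped symmDiff ENNReal

namespace Literature.Probability.LatticeModels

variable {V : Type*} [Fintype V] [DecidableEq V] {G : SimpleGraph V} [DecidableRel G.Adj]

namespace Current

/-! ### Part 1. Eight currents: four pairs `(n_i, n'_i)`; weights, projections, Fubini -/

variable (G) in
/-- The eight currents of the mixing argument for `s = 4`: four pairs `(n_i, n'_i)` of a current and its
auxiliary current (Aizenman–Duminil-Copin 2021, §6.2: "the law of `(n₁,…,n_s,n'₁,…,n'_s)`").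
[cite: AizenmanDuminilCopinAnnals2021, arXiv:1912.07973 §6.2, the measure P^{xy} ⊗ P^∅ (p. 23)] -/
abbrev OctoCfg : Type _ := Fin 4 → Current G × Current G

/-- The unprimed four currents `(n₁,n₂,n₃,n₄)` of an eight-current configuration, grouped as the tree's
`FourCfg` (`((n₁,n₂),(n₃,n₄))`: two pairs, the second current of each pair being the sourced one). [folklore] -/
def octoFst (ω : OctoCfg G) : FourCfg G := (((ω 0).1, (ω 1).1), ((ω 2).1, (ω 3).1))

/-- The primed (auxiliary) four currents `(n'₁,n'₂,n'₃,n'₄)`, grouped as a `FourCfg`. [folklore] -/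
def octoSnd (ω : OctoCfg G) : FourCfg G := (((ω 0).2, (ω 1).2), ((ω 2).2, (ω 3).2))

/-- The weight of the four currents `((n₁,n₂),(n₃,n₄))` with `n₁, n₃` sourceless and `∂n₂ = A₁`,
`∂n₄ = A₂` (general sources for the two sourced currents; the tree's `fourWeight K u a b` is the case
`A₁ = {a}Δ{u}`, `A₂ = {b}Δ{u}`). [cite: AizenmanDuminilCopinAnnals2021, arXiv:1912.07973 §6.2, the measures P^{x₁y₁,x₂y₂,∅,∅}] -/
def srcWeight (K : G.edgeFinset → ℝ) (A₁ A₂ : Finset V) (pq : FourCfg G) : ℝ≥0∞ :=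
  epairWeight K ∅ A₁ pq.1 * epairWeight K ∅ A₂ pq.2

/-- `fourWeight` is `srcWeight` with sources `{a}Δ{u}`, `{b}Δ{u}`. [folklore] -/
theorem fourWeight_eq_srcWeight (K : G.edgeFinset → ℝ) (u a b : V) :
    fourWeight K u a b = srcWeight K ({a} ∆ {u}) ({b} ∆ {u}) := rfl

/-- The un-normalised expectation of a functional of the four currents under `srcWeight`. [folklore] -/
def srcMass (K : G.edgeFinset → ℝ) (A₁ A₂ : Finset V) (Φ : FourCfg G → ℝ≥0∞) : ℝ≥0∞ :=
  ∑' pq, srcWeight K A₁ A₂ pq * Φ pq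

/-- The normalisation `Z[∅]Z[A₁]·Z[∅]Z[A₂]` of `srcWeight`. [folklore] -/
def srcNrm (K : G.edgeFinset → ℝ) (A₁ A₂ : Finset V) : ℝ≥0∞ :=
  ecurrentSum K ∅ * ecurrentSum K A₁ * (ecurrentSum K ∅ * ecurrentSum K A₂)

variable {K : G.edgeFinset → ℝ}

/-- `fourMass = srcMass`. [folklore] -/
theorem fourMass_eq_srcMass (K : G.edgeFinset → ℝ) (u a b : V) (Φ : FourCfg G → ℝ≥0∞) :
    fourMass K u a b Φ = srcMass K ({a} ∆ {u}) ({b} ∆ {u}) Φ := rfl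

/-- `fourNrm = srcNrm`. [folklore] -/
theorem fourNrm_eq_srcNrm (K : G.edgeFinset → ℝ) (u a b : V) :
    fourNrm K u a b = srcNrm K ({a} ∆ {u}) ({b} ∆ {u}) := rfl

/-- `srcMass 1 = srcNrm`. [folklore] -/
theorem srcMass_one (K : G.edgeFinset → ℝ) (A₁ A₂ : Finset V) :
    srcMass K A₁ A₂ (fun _ => 1) = srcNrm K A₁ A₂ := by
  unfold srcMass srcNrm srcWeight
  simp_rw [mul_one]
  rw [← tsum_mul_tsum_eq_tsum_prod (fun p => epairWeight K ∅ A₁ p) (fun q => epairWeight K ∅ A₂ q),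
    tsum_epairWeight, tsum_epairWeight]

/-- Monotonicity of `srcMass`. [folklore] -/
theorem srcMass_mono (K : G.edgeFinset → ℝ) (A₁ A₂ : Finset V) {Φ Ψ : FourCfg G → ℝ≥0∞} (h : ∀ pq, Φ pq ≤ Ψ pq) :
    srcMass K A₁ A₂ Φ ≤ srcMass K A₁ A₂ Ψ :=
  ENNReal.tsum_le_tsum fun pq => mul_le_mul' le_rfl (h pq)

/-- `srcMass Φ ≤ srcNrm` for `Φ ≤ 1`. [folklore] -/
theorem srcMass_le_srcNrm (K : G.edgeFinset → ℝ) (A₁ A₂ : Finset V) {Φ : FourCfg G → ℝ≥0∞} (h : ∀ pq, Φ pq ≤ 1) :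
    srcMass K A₁ A₂ Φ ≤ srcNrm K A₁ A₂ := by
  rw [← srcMass_one]; exact srcMass_mono K A₁ A₂ h

/-- Additivity of `srcMass`. [folklore] -/
theorem srcMass_add (K : G.edgeFinset → ℝ) (A₁ A₂ : Finset V) (Φ Ψ : FourCfg G → ℝ≥0∞) :
    srcMass K A₁ A₂ (Φ + Ψ) = srcMass K A₁ A₂ Φ + srcMass K A₁ A₂ Ψ := by
  unfold srcMass
  rw [← ENNReal.tsum_add]
  exact tsum_congr fun pq => by rw [Pi.add_apply, mul_add]

/-- Homogeneity of `srcMass`. [folklore] -/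
theorem srcMass_const_mul (K : G.edgeFinset → ℝ) (A₁ A₂ : Finset V) (c : ℝ≥0∞) (Φ : FourCfg G → ℝ≥0∞) :
    srcMass K A₁ A₂ (fun pq => c * Φ pq) = c * srcMass K A₁ A₂ Φ := by
  unfold srcMass
  rw [← ENNReal.tsum_mul_left]
  exact tsum_congr fun pq => by ring

/-- The source data of the eight currents before switching: pair `i` carries `({xx i}Δ{yy i}, ∅)` with
`xx = ![w, x₁, w, x₂]`, `yy = ![w, y₁, w, y₂]` — pairs `0`, `2` sourceless (`{w}Δ{w} = ∅`), pairs `1`, `3`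
the sourced currents `∂n₂ = {x₁,y₁}`, `∂n₄ = {x₂,y₂}` of `P^{x₁y₁,x₂y₂,∅,∅} ⊗ P^{∅,∅,∅,∅}`.
[cite: AizenmanDuminilCopinAnnals2021, arXiv:1912.07973 §6.2, the measure P^{xy,∅} (p. 23)] -/
def octoX (w x₁ x₂ : V) : Fin 4 → V := ![w, x₁, w, x₂]

/-- See `octoX`. [folklore] -/
def octoY (w y₁ y₂ : V) : Fin 4 → V := ![w, y₁, w, y₂]

/-- The switch points: `![w, v₁, w, v₂]` (only the sourced pairs are rerouted). [cite: AizenmanDuminilCopinAnnals2021, arXiv:1912.07973 §6.2, the measure P^{xu,uy} (p. 24)] -/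
def octoU (w v₁ v₂ : V) : Fin 4 → V := ![w, v₁, w, v₂]

/-- **Fubini for the eight currents**: a product weight `∏ᵢ 1{∂n_i = A_i}1{∂n'_i = B_i} w w` integrates a
product `H(n) J(n')` of a functional of the unprimed and one of the primed currents to the product of the
two four-current masses. [folklore] -/
theorem tsum_multiPairWeight_mul_mul (K : G.edgeFinset → ℝ) (A B : Fin 4 → Finset V)
    (hA0 : A 0 = ∅) (hA2 : A 2 = ∅) (hB0 : B 0 = ∅) (hB2 : B 2 = ∅)
    (H J : FourCfg G → ℝ≥0∞) :
    ∑' ω : OctoCfg G, multiPairWeight K A B ω * (H (octoFst ω) * J (octoSnd ω)) =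
      srcMass K (A 1) (A 3) H * srcMass K (B 1) (B 3) J := by
  classical
  -- regroup the eight currents as (unprimed four, primed four)
  set e : FourCfg G × FourCfg G ≃ OctoCfg G :=
    { toFun := fun c => ![(c.1.1.1, c.2.1.1), (c.1.1.2, c.2.1.2), (c.1.2.1, c.2.2.1), (c.1.2.2, c.2.2.2)]
      invFun := fun ω => (octoFst ω, octoSnd ω)
      left_inv := fun c => by simp [octoFst, octoSnd]
      right_inv := fun ω => by
        funext i
        fin_cases i <;> simp [octoFst, octoSnd] } with he
  rw [← e.tsum_eq]
  unfold srcMass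
  rw [tsum_mul_tsum_eq_tsum_prod]
  refine tsum_congr fun c => ?_
  simp only [he, Equiv.coe_fn_mk, octoFst, octoSnd, multiPairWeight, srcWeight, Fin.prod_univ_four,
    Matrix.cons_val_zero, Matrix.cons_val_one, Matrix.cons_val, hA0, hA2, hB0, hB2]
  simp only [epairWeight_eq_mul]
  ring

/-! ### Part 2. The variable `𝐍ᵢ` of one sourced pair: mean and second moment -/

/-- **The variable `𝐍ᵢ` of one sourced pair** with abstract non-negative coefficients `c` on the
vertices: `𝐍(m) = ∑_v c(v) 𝟙[v ∈ C_m(x)]` for the total current `m = n_i + n'_i` of the pair (printed: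
`c(u) = 1/(|𝒦| A_{x,y}(2^k))` for `u ∈ 𝔸_y(2^k)`, `k ∈ 𝒦`, and `0` otherwise).
[cite: AizenmanDuminilCopinAnnals2021, arXiv:1912.07973 §6.2, definition of 𝐍ᵢ (p. 23)] -/
def nPair (x : V) (c : V → ℝ≥0∞) (m : Current G) : ℝ≥0∞ :=
  ∑ v, c v * (if v ∈ m.cluster x then 1 else 0)

/-- **`E^{xy,∅}[𝐍ᵢ]` through the three-point identity** ("the switching lemma and the definition of `𝐍ᵢ`
imply that `E^{xy,∅}[𝐍ᵢ] = 1`"): `∑ 1{∂n={x}Δ{y}}1{∂n'=∅} w w 𝐍(n+n') = ∑_v c(v) Z[{y}Δ{v}] Z[{x}Δ{v}]`.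
[cite: AizenmanDuminilCopinAnnals2021, arXiv:1912.07973 §6.2, proof of Prop. 6.6 ("E^{xy,∅}[𝐍ᵢ] = 1", p. 23)] -/
theorem tsum_epairWeight_mul_nPair (hK : ∀ e, 0 ≤ K e) (x y : V) (c : V → ℝ≥0∞) :
    ∑' p : Current G × Current G, epairWeight K ({x} ∆ {y}) ∅ p * nPair x c (p.1 + p.2) =
      ∑ v, c v * (ecurrentSum K ({y} ∆ {v}) * ecurrentSum K ({x} ∆ {v})) := by
  unfold nPair
  simp_rw [Finset.mul_sum]
  rw [Summable.tsum_finsetSum (fun _ _ => ENNReal.summable)]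
  refine Finset.sum_congr rfl fun v _ => ?_
  have h : ∀ p : Current G × Current G, epairWeight K ({x} ∆ {y}) ∅ p * (c v * (if v ∈ (p.1 + p.2).cluster x then 1 else 0)) =
      c v * (epairWeight K ({x} ∆ {y}) ∅ p * (if v ∈ (p.1 + p.2).cluster x then 1 else 0)) := fun p => by ring
  simp_rw [h]
  rw [ENNReal.tsum_mul_left, tsum_epairWeight_mul_indicator_mem_cluster hK x y v]

/-- `𝐍²` expanded: `𝐍(m)² = ∑_{v,w} c(v)c(w) 𝟙[v ∈ C_m(x)] 𝟙[w ∈ C_m(x)]`. [folklore] -/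
theorem nPair_sq (x : V) (c : V → ℝ≥0∞) (m : Current G) :
    nPair x c m ^ 2 = ∑ v, ∑ w, c v * c w *
      ((if v ∈ m.cluster x then 1 else 0) * (if w ∈ m.cluster x then 1 else 0)) := by
  unfold nPair
  rw [sq, Finset.sum_mul_sum]
  refine Finset.sum_congr rfl fun v _ => Finset.sum_congr rfl fun w _ => ?_
  ring

/-- **`E^{xy,∅}[𝐍ᵢ²]` through Proposition A.3** ("`E^{xy,∅}[𝐍ᵢ²] ≤ 1 + C₂/|𝒦|`, which follows from the
inequality (6.5)" — here the reduction of the second moment to the two-site connection bounds):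
`Z[∅] · ∑ 1{∂n={x}Δ{y}}1{∂n'=∅} w w 𝐍(n+n')² ≤ ∑_{v,w} c(v)c(w) (Z[xw]Z[wv]Z[vy] + Z[xv]Z[vw]Z[wy])`.
[cite: AizenmanDuminilCopinAnnals2021, arXiv:1912.07973 §6.2, proof of Prop. 6.6 ((6.5) and "We find by (A.3) that …", p. 23–24)] -/
theorem ecurrentSum_mul_tsum_epairWeight_mul_nPair_sq_le (hK : ∀ e, 0 ≤ K e) (x y : V) (c : V → ℝ≥0∞) :
    ecurrentSum K ∅ * ∑' p : Current G × Current G, epairWeight K ({x} ∆ {y}) ∅ p * nPair x c (p.1 + p.2) ^ 2 ≤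
      ∑ v, ∑ w, c v * c w *
        (ecurrentSum K ({x} ∆ {w}) * ecurrentSum K ({w} ∆ {v}) * ecurrentSum K ({v} ∆ {y}) +
          ecurrentSum K ({x} ∆ {v}) * ecurrentSum K ({v} ∆ {w}) * ecurrentSum K ({w} ∆ {y})) := by
  simp_rw [nPair_sq, Finset.mul_sum]
  rw [Summable.tsum_finsetSum (fun _ _ => ENNReal.summable)]
  simp_rw [Summable.tsum_finsetSum (fun _ _ => ENNReal.summable)]
  rw [Finset.mul_sum]
  refine Finset.sum_le_sum fun v _ => ?_
  rw [Finset.mul_sum]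
  refine Finset.sum_le_sum fun w _ => ?_
  have h : ∀ p : Current G × Current G, epairWeight K ({x} ∆ {y}) ∅ p * (c v * c w *
      ((if v ∈ (p.1 + p.2).cluster x then 1 else 0) * (if w ∈ (p.1 + p.2).cluster x then 1 else 0))) =
      (c v * c w) * (epairWeight K ({x} ∆ {y}) ∅ p *
        ((if v ∈ (p.1 + p.2).cluster x then 1 else 0) * (if w ∈ (p.1 + p.2).cluster x then 1 else 0))) :=
    fun p => by ring
  simp_rw [h]
  rw [ENNReal.tsum_mul_left]
  calc ecurrentSum K ∅ * (c v * c w * ∑' p : Current G × Current G, epairWeight K ({x} ∆ {y}) ∅ p *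
        ((if v ∈ (p.1 + p.2).cluster x then 1 else 0) * (if w ∈ (p.1 + p.2).cluster x then 1 else 0)))
      = c v * c w * (ecurrentSum K ∅ * ∑' p : Current G × Current G, epairWeight K ({x} ∆ {y}) ∅ p *
        ((if v ∈ (p.1 + p.2).cluster x then 1 else 0) * (if w ∈ (p.1 + p.2).cluster x then 1 else 0))) := by ring
    _ ≤ c v * c w * (ecurrentSum K ({x} ∆ {w}) * ecurrentSum K ({w} ∆ {v}) * ecurrentSum K ({v} ∆ {y}) +
          ecurrentSum K ({x} ∆ {v}) * ecurrentSum K ({v} ∆ {w}) * ecurrentSum K ({w} ∆ {y})) :=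
        mul_le_mul' le_rfl (ecurrentSum_empty_mul_tsum_double_conn_le hK x y v w)

/-- `𝐍` is finite when the coefficients are. [folklore] -/
theorem nPair_ne_top {x : V} {c : V → ℝ≥0∞} (hc : ∀ v, c v ≠ ∞) (m : Current G) : nPair x c m ≠ ∞ := by
  unfold nPair
  refine ENNReal.sum_ne_top.2 fun v _ => ENNReal.mul_ne_top (hc v) ?_
  split_ifs <;> simp

/-! ### Part 3. The weighted Cauchy–Schwarz inequality and the deviation `|𝐍 - 1|` -/

/-- `2ab ≤ a² + b²` in `ℝ≥0∞`. [folklore] -/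
theorem two_mul_mul_le_sq_add_sq' (a b : ℝ≥0∞) : 2 * (a * b) ≤ a ^ 2 + b ^ 2 := by
  rcases eq_or_ne a ∞ with rfl | ha
  · simp
  rcases eq_or_ne b ∞ with rfl | hb
  · simp
  have h : 2 * (a.toReal * b.toReal) ≤ a.toReal ^ 2 + b.toReal ^ 2 := by nlinarith [sq_nonneg (a.toReal - b.toReal)]
  calc 2 * (a * b) = ENNReal.ofReal (2 * (a.toReal * b.toReal)) := by
        rw [ENNReal.ofReal_mul zero_le_two, ENNReal.ofReal_ofNat, ENNReal.ofReal_mul ENNReal.toReal_nonneg,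
          ENNReal.ofReal_toReal ha, ENNReal.ofReal_toReal hb]
    _ ≤ ENNReal.ofReal (a.toReal ^ 2 + b.toReal ^ 2) := ENNReal.ofReal_le_ofReal h
    _ = a ^ 2 + b ^ 2 := by
        rw [ENNReal.ofReal_add (sq_nonneg _) (sq_nonneg _), ENNReal.ofReal_pow ENNReal.toReal_nonneg,
          ENNReal.ofReal_pow ENNReal.toReal_nonneg, ENNReal.ofReal_toReal ha, ENNReal.ofReal_toReal hb]

/-- **Weighted Cauchy–Schwarz in `ℝ≥0∞`**: `(∑ w f g)² ≤ (∑ w f²)(∑ w g²)` (symmetrisation of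
`2ab ≤ a² + b²`). [folklore] -/
theorem tsum_mul_mul_sq_le {ι : Type*} (w f g : ι → ℝ≥0∞) :
    (∑' i, w i * (f i * g i)) ^ 2 ≤ (∑' i, w i * f i ^ 2) * ∑' i, w i * g i ^ 2 := by
  have h2 : (2 : ℝ≥0∞) ≠ 0 := two_ne_zero
  have h2' : (2 : ℝ≥0∞) ≠ ∞ := ENNReal.ofNat_ne_top
  rw [← ENNReal.mul_le_mul_iff_right h2 h2']
  -- both sides as double sums
  rw [sq, tsum_mul_tsum_eq_tsum_prod, tsum_mul_tsum_eq_tsum_prod, ← ENNReal.tsum_mul_left, ← ENNReal.tsum_mul_left]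
  have hsymm : ∑' p : ι × ι, w p.1 * f p.1 ^ 2 * (w p.2 * g p.2 ^ 2) =
      ∑' p : ι × ι, w p.2 * f p.2 ^ 2 * (w p.1 * g p.1 ^ 2) := by
    rw [← (Equiv.prodComm ι ι).tsum_eq]
    rfl
  calc ∑' p : ι × ι, 2 * (w p.1 * (f p.1 * g p.1) * (w p.2 * (f p.2 * g p.2)))
      ≤ ∑' p : ι × ι, (w p.1 * f p.1 ^ 2 * (w p.2 * g p.2 ^ 2) + w p.2 * f p.2 ^ 2 * (w p.1 * g p.1 ^ 2)) := by
        refine ENNReal.tsum_le_tsum fun p => ?_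
        have h := two_mul_mul_le_sq_add_sq' (f p.1 * g p.2) (f p.2 * g p.1)
        calc 2 * (w p.1 * (f p.1 * g p.1) * (w p.2 * (f p.2 * g p.2)))
            = w p.1 * w p.2 * (2 * (f p.1 * g p.2 * (f p.2 * g p.1))) := by ring
          _ ≤ w p.1 * w p.2 * ((f p.1 * g p.2) ^ 2 + (f p.2 * g p.1) ^ 2) := mul_le_mul' le_rfl h
          _ = _ := by ring
    _ = ∑' p : ι × ι, w p.1 * f p.1 ^ 2 * (w p.2 * g p.2 ^ 2) + ∑' p : ι × ι, w p.2 * f p.2 ^ 2 * (w p.1 * g p.1 ^ 2) :=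
        ENNReal.tsum_add
    _ = ∑' p : ι × ι, w p.1 * f p.1 ^ 2 * (w p.2 * g p.2 ^ 2) + ∑' p : ι × ι, w p.1 * f p.1 ^ 2 * (w p.2 * g p.2 ^ 2) := by
        rw [← hsymm]
    _ = ∑' p : ι × ι, 2 * (w p.1 * f p.1 ^ 2 * (w p.2 * g p.2 ^ 2)) := by
        rw [← ENNReal.tsum_add]
        exact tsum_congr fun p => by ring

/-- The deviation `|n - 1|` of a finite `n ∈ ℝ≥0∞` from `1`, as an element of `ℝ≥0∞`. [folklore] -/
def devOne (n : ℝ≥0∞) : ℝ≥0∞ := ENNReal.ofReal |n.toReal - 1|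

/-- `n ≤ 1 + |n - 1|`. [folklore] -/
theorem le_one_add_devOne {n : ℝ≥0∞} (hn : n ≠ ∞) : n ≤ 1 + devOne n := by
  unfold devOne
  rw [← ENNReal.ofReal_toReal hn, ← ENNReal.ofReal_one, ← ENNReal.ofReal_add zero_le_one (abs_nonneg _)]
  refine ENNReal.ofReal_le_ofReal ?_
  rw [ENNReal.toReal_ofReal ENNReal.toReal_nonneg]
  have := le_abs_self (n.toReal - 1)
  linarith

/-- `1 ≤ n + |n - 1|`. [folklore] -/
theorem one_le_add_devOne {n : ℝ≥0∞} (hn : n ≠ ∞) : 1 ≤ n + devOne n := by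
  unfold devOne
  rw [← ENNReal.ofReal_toReal hn, ← ENNReal.ofReal_one, ← ENNReal.ofReal_add ENNReal.toReal_nonneg (abs_nonneg _)]
  refine ENNReal.ofReal_le_ofReal ?_
  rw [ENNReal.toReal_ofReal ENNReal.toReal_nonneg]
  have := neg_abs_le (n.toReal - 1)
  linarith

/-- **The variance identity** `n² + 1 = |n-1|² + 2n` in `ℝ≥0∞` (finite `n`). [folklore] -/
theorem sq_add_one_eq_devOne_sq_add {n : ℝ≥0∞} (hn : n ≠ ∞) : n ^ 2 + 1 = devOne n ^ 2 + 2 * n := by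
  unfold devOne
  rw [← ENNReal.ofReal_toReal hn]
  rw [ENNReal.toReal_ofReal ENNReal.toReal_nonneg, ← ENNReal.ofReal_pow ENNReal.toReal_nonneg,
    ← ENNReal.ofReal_one, ← ENNReal.ofReal_add (pow_nonneg ENNReal.toReal_nonneg 2) zero_le_one,
    ← ENNReal.ofReal_pow (abs_nonneg _), ← ENNReal.ofReal_ofNat, ← ENNReal.ofReal_mul zero_le_two,
    ← ENNReal.ofReal_add (pow_nonneg (abs_nonneg _) 2) (by positivity)]
  congr 1
  rw [sq_abs]
  ring

/-! ### Part 4. The switching step and the approximate factorisation (6.16) -/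

/-- **Fubini over finitely many independent coordinates in `ℝ≥0∞`**: `∑_{f : Fin n → X} ∏ᵢ gᵢ(f i) = ∏ᵢ ∑_x gᵢ(x)`. [folklore] -/
theorem tsum_pi_fin_prod {X : Type*} : ∀ (n : ℕ) (g : Fin n → X → ℝ≥0∞),
    ∑' f : Fin n → X, ∏ i, g i (f i) = ∏ i, ∑' x, g i x := by
  intro n
  induction n with
  | zero =>
    intro g
    simp
  | succ n ih =>
    intro g
    rw [← (Fin.consEquiv fun _ => X).tsum_eq, ENNReal.tsum_prod', Fin.prod_univ_succ, ← ih fun i => g i.succ,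
      tsum_mul_tsum_eq_tsum_prod, ENNReal.tsum_prod']
    refine tsum_congr fun a => tsum_congr fun f => ?_
    simp [Fin.prod_univ_succ]

variable (K) in
/-- The base eight-current weight `P^{x₁y₁,x₂y₂,∅,∅} ⊗ P^{∅,∅,∅,∅}`: pair `i` has sources
`({octoX i}Δ{octoY i}, ∅)`. [cite: AizenmanDuminilCopinAnnals2021, arXiv:1912.07973 §6.2, the measure P^{xy,∅} (p. 23)] -/
def octoWeight (w x₁ x₂ y₁ y₂ : V) (ω : OctoCfg G) : ℝ≥0∞ :=
  multiPairWeight K (fun i => {octoX w x₁ x₂ i} ∆ {octoY w y₁ y₂ i}) (fun _ => ∅) ω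

variable (K) in
/-- The switched eight-current weight `P^{x₁v₁,x₂v₂,∅,∅} ⊗ P^{v₁y₁,v₂y₂,∅,∅}` (printed `P^{xu,uy}`): pair `i`
has sources `({octoX i}Δ{octoU i}, {octoU i}Δ{octoY i})`. [cite: AizenmanDuminilCopinAnnals2021, arXiv:1912.07973 §6.2, the measure P^{xu,uy} (p. 24)] -/
def octoWeightSw (w x₁ x₂ y₁ y₂ v₁ v₂ : V) (ω : OctoCfg G) : ℝ≥0∞ :=
  multiPairWeight K (fun i => {octoX w x₁ x₂ i} ∆ {octoU w v₁ v₂ i})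
    (fun i => {octoU w v₁ v₂ i} ∆ {octoY w y₁ y₂ i}) ω

open Classical in
/-- The indicator of the failure `G(v₁,v₂)ᶜ` of one of the four split events. [cite: AizenmanDuminilCopinAnnals2021, arXiv:1912.07973 §6.2, Lemma 6.7 (the event G(u₁,…,u_t)^c, p. 24)] -/
def splitFailInd (Ein Eout : Finset G.edgeFinset) (u y : Fin 4 → V) (ω : OctoCfg G) : ℝ≥0∞ :=
  if ∀ i, SplitEvent Ein Eout (u i) (y i) ((ω i).1 + (ω i).2) then 0 else 1

/-- `multiSplitInd` is the indicator of "all four split events". [folklore] -/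
theorem multiSplitInd_eq_ite (Ein Eout : Finset G.edgeFinset) (u y : Fin 4 → V) (ω : OctoCfg G)
    [Decidable (∀ i, SplitEvent Ein Eout (u i) (y i) ((ω i).1 + (ω i).2))] :
    multiSplitInd Ein Eout u y ω = if ∀ i, SplitEvent Ein Eout (u i) (y i) ((ω i).1 + (ω i).2) then 1 else 0 := by
  classical
  unfold multiSplitInd
  split_ifs with h
  · exact Finset.prod_eq_one fun i _ => if_pos (h i)
  · push Not at h
    obtain ⟨i, hi⟩ := h
    exact Finset.prod_eq_zero (Finset.mem_univ i) (if_neg hi)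

/-- `𝟙[G] + 𝟙[Gᶜ] = 1`. [folklore] -/
theorem multiSplitInd_add_splitFailInd (Ein Eout : Finset G.edgeFinset) (u y : Fin 4 → V) (ω : OctoCfg G) :
    multiSplitInd Ein Eout u y ω + splitFailInd Ein Eout u y ω = 1 := by
  classical
  rw [multiSplitInd_eq_ite]
  unfold splitFailInd
  split_ifs <;> simp

/-- `𝟙[G] ≤ 1`. [folklore] -/
theorem multiSplitInd_le_one (Ein Eout : Finset G.edgeFinset) (u y : Fin 4 → V) (ω : OctoCfg G) :
    multiSplitInd Ein Eout u y ω ≤ 1 := by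
  classical
  rw [multiSplitInd_eq_ite]
  split_ifs <;> simp

/-- `𝟙[Gᶜ] ≤ 1`. [folklore] -/
theorem splitFailInd_le_one (Ein Eout : Finset G.edgeFinset) (u y : Fin 4 → V) (ω : OctoCfg G) :
    splitFailInd Ein Eout u y ω ≤ 1 := by
  unfold splitFailInd
  split_ifs <;> simp

section Sources

variable (w x₁ x₂ y₁ y₂ v₁ v₂ : V)

/-- Source bookkeeping for the base weight: pairs `0`, `2` are sourceless, `1`, `3` carry
`{x₁}Δ{y₁}`, `{x₂}Δ{y₂}`. [folklore] -/
theorem octo_sources_base :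
    ({octoX w x₁ x₂ 0} ∆ {octoY w y₁ y₂ 0} : Finset V) = ∅ ∧
    ({octoX w x₁ x₂ 1} ∆ {octoY w y₁ y₂ 1} : Finset V) = {x₁} ∆ {y₁} ∧
    ({octoX w x₁ x₂ 2} ∆ {octoY w y₁ y₂ 2} : Finset V) = ∅ ∧
    ({octoX w x₁ x₂ 3} ∆ {octoY w y₁ y₂ 3} : Finset V) = {x₂} ∆ {y₂} := by
  simp [octoX, octoY, symmDiff_self]

/-- Source bookkeeping for the switched weight, unprimed currents: `∅, {x₁}Δ{v₁}, ∅, {x₂}Δ{v₂}`. [folklore] -/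
theorem octo_sources_sw_fst :
    ({octoX w x₁ x₂ 0} ∆ {octoU w v₁ v₂ 0} : Finset V) = ∅ ∧
    ({octoX w x₁ x₂ 1} ∆ {octoU w v₁ v₂ 1} : Finset V) = {x₁} ∆ {v₁} ∧
    ({octoX w x₁ x₂ 2} ∆ {octoU w v₁ v₂ 2} : Finset V) = ∅ ∧
    ({octoX w x₁ x₂ 3} ∆ {octoU w v₁ v₂ 3} : Finset V) = {x₂} ∆ {v₂} := by
  simp [octoX, octoU, symmDiff_self]

/-- Source bookkeeping for the switched weight, primed currents: `∅, {v₁}Δ{y₁}, ∅, {v₂}Δ{y₂}`. [folklore] -/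
theorem octo_sources_sw_snd :
    ({octoU w v₁ v₂ 0} ∆ {octoY w y₁ y₂ 0} : Finset V) = ∅ ∧
    ({octoU w v₁ v₂ 1} ∆ {octoY w y₁ y₂ 1} : Finset V) = {v₁} ∆ {y₁} ∧
    ({octoU w v₁ v₂ 2} ∆ {octoY w y₁ y₂ 2} : Finset V) = ∅ ∧
    ({octoU w v₁ v₂ 3} ∆ {octoY w y₁ y₂ 3} : Finset V) = {v₂} ∆ {y₂} := by
  simp [octoU, octoY, symmDiff_self]

end Sources

/-- **The base mass of a functional of the unprimed currents**: `∑ W₀ H(n) = srcMass H · Z[∅]⁴` (the four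
auxiliary currents integrate out). [folklore] -/
theorem tsum_octoWeight_mul_fst (K : G.edgeFinset → ℝ) (w x₁ x₂ y₁ y₂ : V) (H : FourCfg G → ℝ≥0∞) :
    ∑' ω : OctoCfg G, octoWeight K w x₁ x₂ y₁ y₂ ω * H (octoFst ω) =
      srcMass K ({x₁} ∆ {y₁}) ({x₂} ∆ {y₂}) H * ecurrentSum K ∅ ^ 4 := by
  obtain ⟨h0, h1, h2, h3⟩ := octo_sources_base w x₁ x₂ y₁ y₂
  have h := tsum_multiPairWeight_mul_mul K (fun i => {octoX w x₁ x₂ i} ∆ {octoY w y₁ y₂ i}) (fun _ => ∅)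
    h0 h2 rfl rfl H (fun _ => 1)
  simp only [mul_one] at h
  unfold octoWeight
  rw [h, h1, h3, srcMass_one]
  unfold srcNrm
  ring

/-- **(6.15), the independence under the switched measure**: `∑ W_sw Φ(n)Ψ(n') = srcMass^{xv}[Φ] · srcMass^{vy}[Ψ]`
("`P^{xu,uy}[(n) ∈ E, (n') ∈ F] = P^{xu}[E] P^{uy}[F]`"). [cite: AizenmanDuminilCopinAnnals2021, arXiv:1912.07973 §6.2, (6.15) (p. 24)] -/
theorem tsum_octoWeightSw_mul_mul (K : G.edgeFinset → ℝ) (w x₁ x₂ y₁ y₂ v₁ v₂ : V) (Φ Ψ : FourCfg G → ℝ≥0∞) :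
    ∑' ω : OctoCfg G, octoWeightSw K w x₁ x₂ y₁ y₂ v₁ v₂ ω * (Φ (octoFst ω) * Ψ (octoSnd ω)) =
      srcMass K ({x₁} ∆ {v₁}) ({x₂} ∆ {v₂}) Φ * srcMass K ({v₁} ∆ {y₁}) ({v₂} ∆ {y₂}) Ψ := by
  obtain ⟨h0, h1, h2, h3⟩ := octo_sources_sw_fst w x₁ x₂ v₁ v₂
  obtain ⟨k0, k1, k2, k3⟩ := octo_sources_sw_snd w y₁ y₂ v₁ v₂
  have h := tsum_multiPairWeight_mul_mul K (fun i => {octoX w x₁ x₂ i} ∆ {octoU w v₁ v₂ i})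
    (fun i => {octoU w v₁ v₂ i} ∆ {octoY w y₁ y₂ i}) h0 h2 k0 k2 Φ Ψ
  unfold octoWeightSw
  rw [h, h1, h3, k1, k3]

/-- The total switched mass: `∑ W_sw = Z[∅]⁴ Z[x₁v₁]Z[v₁y₁]Z[x₂v₂]Z[v₂y₂]`. [folklore] -/
theorem tsum_octoWeightSw (K : G.edgeFinset → ℝ) (w x₁ x₂ y₁ y₂ v₁ v₂ : V) :
    ∑' ω : OctoCfg G, octoWeightSw K w x₁ x₂ y₁ y₂ v₁ v₂ ω =
      ecurrentSum K ∅ ^ 4 * (ecurrentSum K ({x₁} ∆ {v₁}) * ecurrentSum K ({v₁} ∆ {y₁})) *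
        (ecurrentSum K ({x₂} ∆ {v₂}) * ecurrentSum K ({v₂} ∆ {y₂})) := by
  have h := tsum_octoWeightSw_mul_mul K w x₁ x₂ y₁ y₂ v₁ v₂ (fun _ => 1) (fun _ => 1)
  simp only [mul_one] at h
  rw [h, srcMass_one, srcMass_one]
  unfold srcNrm
  ring

/-- **(6.14) for the eight currents of this file** (from `tsum_multiPair_switch_local`): for `Φ` local on
`E_in`, `Ψ` local on `E_out`,
`∑ W₀ Φ(n)Ψ(n) 𝟙[v₁ ↔ x₁ in n₂+n'₂]𝟙[v₂ ↔ x₂ in n₄+n'₄] 𝟙[G] = ∑ W_sw Φ(n)Ψ(n') 𝟙[G]`.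
[cite: AizenmanDuminilCopinAnnals2021, arXiv:1912.07973 §6.2, (6.14) (p. 24)] -/
theorem tsum_octoWeight_switch (hK : ∀ e, 0 ≤ K e) (Ein Eout : Finset G.edgeFinset) (w x₁ x₂ y₁ y₂ v₁ v₂ : V)
    {Φ Ψ : FourCfg G → ℝ≥0∞} (hΦ : FourLocal Ein Φ) (hΨ : FourLocal Eout Ψ) :
    ∑' ω : OctoCfg G, octoWeight K w x₁ x₂ y₁ y₂ ω *
        (Φ (octoFst ω) * Ψ (octoFst ω) * multiConnInd (octoX w x₁ x₂) (octoU w v₁ v₂) ω *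
          multiSplitInd Ein Eout (octoU w v₁ v₂) (octoY w y₁ y₂) ω) =
      ∑' ω : OctoCfg G, octoWeightSw K w x₁ x₂ y₁ y₂ v₁ v₂ ω *
        (Φ (octoFst ω) * Ψ (octoSnd ω) * multiSplitInd Ein Eout (octoU w v₁ v₂) (octoY w y₁ y₂) ω) := by
  -- the functionals as functions of the 4-tuple of currents
  set grp : (Fin 4 → Current G) → FourCfg G := fun c => ((c 0, c 1), (c 2, c 3)) with hgrp
  have hloc : ∀ {A : Finset G.edgeFinset} {Θ : FourCfg G → ℝ≥0∞}, FourLocal A Θ → CoordLocal A (fun c => Θ (grp c)) := by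
    intro A Θ hΘ i c n n' h
    refine hΘ _ _ fun e he => ?_
    have hi : ∀ j : Fin 4, Function.update c i n j e = Function.update c i n' j e := by
      intro j
      by_cases hj : j = i
      · subst hj; simp [h e he]
      · simp [Function.update_of_ne hj]
    exact ⟨hi 0, hi 1, hi 2, hi 3⟩
  have h := tsum_multiPair_switch_local hK Ein Eout 4 (octoX w x₁ x₂) (octoY w y₁ y₂) (octoU w v₁ v₂)
    (fun c => Φ (grp c)) (fun c => Ψ (grp c)) (hloc hΦ) (hloc hΨ)
  exact h

/-- **The connection mass is the switched total mass**: `∑ W₀ 𝟙[v₁ ↔ x₁]𝟙[v₂ ↔ x₂] = ∑ W_sw` (the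
three-point identity of the switching lemma for each sourced pair; the step
`E^{xy,∅}[𝟙[u ↔ x]] = a_{x,y}(u)`). [cite: AizenmanDuminilCopinAnnals2021, arXiv:1912.07973 §6.2, "E^{xy,∅}[𝐍ᵢ] = 1" and Appendix A.2, Prop. A.3 (first display)] -/
theorem tsum_octoWeight_mul_multiConnInd (hK : ∀ e, 0 ≤ K e) (w x₁ x₂ y₁ y₂ v₁ v₂ : V) :
    ∑' ω : OctoCfg G, octoWeight K w x₁ x₂ y₁ y₂ ω * multiConnInd (octoX w x₁ x₂) (octoU w v₁ v₂) ω =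
      ∑' ω : OctoCfg G, octoWeightSw K w x₁ x₂ y₁ y₂ v₁ v₂ ω := by
  unfold octoWeight octoWeightSw multiPairWeight multiConnInd
  simp_rw [← Finset.prod_mul_distrib]
  rw [tsum_pi_fin_prod 4 (fun i p => epairWeight K ({octoX w x₁ x₂ i} ∆ {octoY w y₁ y₂ i}) ∅ p *
      (if octoU w v₁ v₂ i ∈ (p.1 + p.2).cluster (octoX w x₁ x₂ i) then 1 else 0)),
    tsum_pi_fin_prod 4 (fun i p => epairWeight K ({octoX w x₁ x₂ i} ∆ {octoU w v₁ v₂ i})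
      ({octoU w v₁ v₂ i} ∆ {octoY w y₁ y₂ i}) p)]
  refine Finset.prod_congr rfl fun i _ => ?_
  rw [tsum_epairWeight_mul_indicator_mem_cluster hK, tsum_epairWeight]
  fin_cases i <;> simp [octoX, octoY, octoU, symmDiff_self, symmDiff_comm, mul_comm]

/-- `∑ W₀ 𝟙c 𝟙[Gᶜ] = ∑ W_sw 𝟙[Gᶜ]` — the failure of the split events seen from the base measure
(`∑ W₀ 𝟙c 𝟙[G] = ∑ W_sw 𝟙[G]` by (6.14) with `Φ = Ψ = 1`, and `∑ W₀ 𝟙c = ∑ W_sw`). [cite: AizenmanDuminilCopinAnnals2021, arXiv:1912.07973 §6.2, Lemma 6.7 (first identity of its display, p. 24)] -/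
theorem tsum_octoWeight_mul_conn_mul_splitFail (hK : ∀ e, 0 ≤ K e) (Ein Eout : Finset G.edgeFinset)
    (w x₁ x₂ y₁ y₂ v₁ v₂ : V) :
    ∑' ω : OctoCfg G, octoWeight K w x₁ x₂ y₁ y₂ ω *
        (multiConnInd (octoX w x₁ x₂) (octoU w v₁ v₂) ω * splitFailInd Ein Eout (octoU w v₁ v₂) (octoY w y₁ y₂) ω) =
      ∑' ω : OctoCfg G, octoWeightSw K w x₁ x₂ y₁ y₂ v₁ v₂ ω * splitFailInd Ein Eout (octoU w v₁ v₂) (octoY w y₁ y₂) ω := by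
  have hZtop : ∀ A, ecurrentSum K A ≠ ∞ := fun A => ecurrentSum_ne_top hK A
  -- `∑ W₀ 𝟙c 𝟙G = ∑ W_sw 𝟙G`
  have hG := tsum_octoWeight_switch hK Ein Eout w x₁ x₂ y₁ y₂ v₁ v₂ (Φ := fun _ => 1) (Ψ := fun _ => 1)
    (fourLocal_const _ _) (fourLocal_const _ _)
  simp only [one_mul] at hG
  -- `∑ W₀ 𝟙c = ∑ W_sw`
  have hT := tsum_octoWeight_mul_multiConnInd hK w x₁ x₂ y₁ y₂ v₁ v₂
  -- split `1 = 𝟙G + 𝟙Gᶜ` on both sides and cancel the `𝟙G` parts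
  have hL : ∑' ω : OctoCfg G, octoWeight K w x₁ x₂ y₁ y₂ ω * multiConnInd (octoX w x₁ x₂) (octoU w v₁ v₂) ω =
      ∑' ω : OctoCfg G, octoWeight K w x₁ x₂ y₁ y₂ ω *
        (multiConnInd (octoX w x₁ x₂) (octoU w v₁ v₂) ω * multiSplitInd Ein Eout (octoU w v₁ v₂) (octoY w y₁ y₂) ω) +
      ∑' ω : OctoCfg G, octoWeight K w x₁ x₂ y₁ y₂ ω *
        (multiConnInd (octoX w x₁ x₂) (octoU w v₁ v₂) ω * splitFailInd Ein Eout (octoU w v₁ v₂) (octoY w y₁ y₂) ω) := by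
    rw [← ENNReal.tsum_add]
    refine tsum_congr fun ω => ?_
    rw [← mul_add, ← mul_add, multiSplitInd_add_splitFailInd, mul_one]
  have hR : ∑' ω : OctoCfg G, octoWeightSw K w x₁ x₂ y₁ y₂ v₁ v₂ ω =
      ∑' ω : OctoCfg G, octoWeightSw K w x₁ x₂ y₁ y₂ v₁ v₂ ω * multiSplitInd Ein Eout (octoU w v₁ v₂) (octoY w y₁ y₂) ω +
      ∑' ω : OctoCfg G, octoWeightSw K w x₁ x₂ y₁ y₂ v₁ v₂ ω * splitFailInd Ein Eout (octoU w v₁ v₂) (octoY w y₁ y₂) ω := by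
    rw [← ENNReal.tsum_add]
    refine tsum_congr fun ω => ?_
    rw [← mul_add, multiSplitInd_add_splitFailInd, mul_one]
  have hfin : ∑' ω : OctoCfg G, octoWeightSw K w x₁ x₂ y₁ y₂ v₁ v₂ ω *
      multiSplitInd Ein Eout (octoU w v₁ v₂) (octoY w y₁ y₂) ω ≠ ∞ := by
    have htot : ∑' ω : OctoCfg G, octoWeightSw K w x₁ x₂ y₁ y₂ v₁ v₂ ω ≠ ∞ := by
      rw [tsum_octoWeightSw]
      exact ENNReal.mul_ne_top (ENNReal.mul_ne_top (ENNReal.pow_ne_top (hZtop _))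
        (ENNReal.mul_ne_top (hZtop _) (hZtop _))) (ENNReal.mul_ne_top (hZtop _) (hZtop _))
    refine ne_top_of_le_ne_top htot (ENNReal.tsum_le_tsum fun ω => ?_)
    calc _ ≤ octoWeightSw K w x₁ x₂ y₁ y₂ v₁ v₂ ω * 1 := mul_le_mul' le_rfl (multiSplitInd_le_one _ _ _ _ _)
      _ = _ := mul_one _
  rw [hL, hG, hR] at hT
  exact (ENNReal.add_right_inj hfin).1 hT

/-- **The two-sided comparison for fixed switch points** (the heart of the derivation of (6.16)): with
`T(v) = ∑ W₀ Φ(n)Ψ(n)𝟙[v₁ ↔ x₁]𝟙[v₂ ↔ x₂]`, `M(v) = srcMass^{xv}[Φ] srcMass^{vy}[Ψ]` and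
`R(v) = ∑ W_sw 𝟙[Gᶜ]`: `T(v) ≤ M(v) + R(v)` and `M(v) ≤ T(v) + R(v)` (for `Φ, Ψ ≤ 1` local on `E_in`,
`E_out`). [cite: AizenmanDuminilCopinAnnals2021, arXiv:1912.07973 §6.2, (6.14)–(6.16) (p. 24–25)] -/
theorem tsum_octoWeight_conn_le_and_ge (hK : ∀ e, 0 ≤ K e) (Ein Eout : Finset G.edgeFinset)
    (w x₁ x₂ y₁ y₂ v₁ v₂ : V) {Φ Ψ : FourCfg G → ℝ≥0∞} (hΦ1 : ∀ pq, Φ pq ≤ 1) (hΨ1 : ∀ pq, Ψ pq ≤ 1)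
    (hΦ : FourLocal Ein Φ) (hΨ : FourLocal Eout Ψ) :
    (∑' ω : OctoCfg G, octoWeight K w x₁ x₂ y₁ y₂ ω *
        (Φ (octoFst ω) * Ψ (octoFst ω) * multiConnInd (octoX w x₁ x₂) (octoU w v₁ v₂) ω) ≤
      srcMass K ({x₁} ∆ {v₁}) ({x₂} ∆ {v₂}) Φ * srcMass K ({v₁} ∆ {y₁}) ({v₂} ∆ {y₂}) Ψ +
        ∑' ω : OctoCfg G, octoWeightSw K w x₁ x₂ y₁ y₂ v₁ v₂ ω *
          splitFailInd Ein Eout (octoU w v₁ v₂) (octoY w y₁ y₂) ω) ∧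
    (srcMass K ({x₁} ∆ {v₁}) ({x₂} ∆ {v₂}) Φ * srcMass K ({v₁} ∆ {y₁}) ({v₂} ∆ {y₂}) Ψ ≤
      (∑' ω : OctoCfg G, octoWeight K w x₁ x₂ y₁ y₂ ω *
        (Φ (octoFst ω) * Ψ (octoFst ω) * multiConnInd (octoX w x₁ x₂) (octoU w v₁ v₂) ω)) +
        ∑' ω : OctoCfg G, octoWeightSw K w x₁ x₂ y₁ y₂ v₁ v₂ ω *
          splitFailInd Ein Eout (octoU w v₁ v₂) (octoY w y₁ y₂) ω) := by
  set X := octoX w x₁ x₂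
  set Y := octoY w y₁ y₂
  set U := octoU w v₁ v₂
  have hsw := tsum_octoWeight_switch hK Ein Eout w x₁ x₂ y₁ y₂ v₁ v₂ hΦ hΨ
  have hfail := tsum_octoWeight_mul_conn_mul_splitFail hK Ein Eout w x₁ x₂ y₁ y₂ v₁ v₂
  have hind := tsum_octoWeightSw_mul_mul K w x₁ x₂ y₁ y₂ v₁ v₂ Φ Ψ
  have hΦΨ1 : ∀ ω : OctoCfg G, Φ (octoFst ω) * Ψ (octoFst ω) ≤ 1 := fun ω =>
    (mul_le_mul' (hΦ1 _) (hΨ1 _)).trans (le_of_eq (one_mul 1))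
  have hΦΨ1' : ∀ ω : OctoCfg G, Φ (octoFst ω) * Ψ (octoSnd ω) ≤ 1 := fun ω =>
    (mul_le_mul' (hΦ1 _) (hΨ1 _)).trans (le_of_eq (one_mul 1))
  constructor
  · -- `T = ∑ W₀ ΦΨ𝟙c𝟙G + ∑ W₀ ΦΨ𝟙c𝟙Gᶜ ≤ ∑ W_sw ΦΨ'𝟙G + ∑ W₀ 𝟙c𝟙Gᶜ ≤ ∑ W_sw ΦΨ' + ∑ W_sw 𝟙Gᶜ`
    calc ∑' ω : OctoCfg G, octoWeight K w x₁ x₂ y₁ y₂ ω * (Φ (octoFst ω) * Ψ (octoFst ω) * multiConnInd X U ω)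
        = ∑' ω : OctoCfg G, octoWeight K w x₁ x₂ y₁ y₂ ω *
            (Φ (octoFst ω) * Ψ (octoFst ω) * multiConnInd X U ω * multiSplitInd Ein Eout U Y ω) +
          ∑' ω : OctoCfg G, octoWeight K w x₁ x₂ y₁ y₂ ω *
            (Φ (octoFst ω) * Ψ (octoFst ω) * multiConnInd X U ω * splitFailInd Ein Eout U Y ω) := by
          rw [← ENNReal.tsum_add]
          refine tsum_congr fun ω => ?_
          rw [← mul_add, ← mul_add, multiSplitInd_add_splitFailInd, mul_one]
      _ ≤ ∑' ω : OctoCfg G, octoWeightSw K w x₁ x₂ y₁ y₂ v₁ v₂ ω *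
            (Φ (octoFst ω) * Ψ (octoSnd ω) * multiSplitInd Ein Eout U Y ω) +
          ∑' ω : OctoCfg G, octoWeight K w x₁ x₂ y₁ y₂ ω * (multiConnInd X U ω * splitFailInd Ein Eout U Y ω) := by
          rw [hsw]
          refine add_le_add le_rfl (ENNReal.tsum_le_tsum fun ω => mul_le_mul' le_rfl ?_)
          calc Φ (octoFst ω) * Ψ (octoFst ω) * multiConnInd X U ω * splitFailInd Ein Eout U Y ω
              ≤ 1 * multiConnInd X U ω * splitFailInd Ein Eout U Y ω :=
                mul_le_mul' (mul_le_mul' (hΦΨ1 ω) le_rfl) le_rfl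
            _ = _ := by rw [one_mul]
      _ ≤ ∑' ω : OctoCfg G, octoWeightSw K w x₁ x₂ y₁ y₂ v₁ v₂ ω * (Φ (octoFst ω) * Ψ (octoSnd ω)) +
          ∑' ω : OctoCfg G, octoWeightSw K w x₁ x₂ y₁ y₂ v₁ v₂ ω * splitFailInd Ein Eout U Y ω := by
          rw [hfail]
          refine add_le_add (ENNReal.tsum_le_tsum fun ω => mul_le_mul' le_rfl ?_) le_rfl
          calc Φ (octoFst ω) * Ψ (octoSnd ω) * multiSplitInd Ein Eout U Y ω
              ≤ Φ (octoFst ω) * Ψ (octoSnd ω) * 1 := mul_le_mul' le_rfl (multiSplitInd_le_one _ _ _ _ _)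
            _ = _ := mul_one _
      _ = _ := by rw [hind]
  · -- `M = ∑ W_sw ΦΨ' ≤ ∑ W_sw ΦΨ'𝟙G + ∑ W_sw 𝟙Gᶜ = ∑ W₀ ΦΨ𝟙c𝟙G + ∑ W_sw 𝟙Gᶜ ≤ T + ∑ W_sw 𝟙Gᶜ`
    calc srcMass K ({x₁} ∆ {v₁}) ({x₂} ∆ {v₂}) Φ * srcMass K ({v₁} ∆ {y₁}) ({v₂} ∆ {y₂}) Ψ
        = ∑' ω : OctoCfg G, octoWeightSw K w x₁ x₂ y₁ y₂ v₁ v₂ ω * (Φ (octoFst ω) * Ψ (octoSnd ω)) := hind.symm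
      _ ≤ ∑' ω : OctoCfg G, octoWeightSw K w x₁ x₂ y₁ y₂ v₁ v₂ ω *
            (Φ (octoFst ω) * Ψ (octoSnd ω) * multiSplitInd Ein Eout U Y ω) +
          ∑' ω : OctoCfg G, octoWeightSw K w x₁ x₂ y₁ y₂ v₁ v₂ ω * splitFailInd Ein Eout U Y ω := by
          rw [← ENNReal.tsum_add]
          refine ENNReal.tsum_le_tsum fun ω => ?_
          rw [← mul_add]
          refine mul_le_mul' le_rfl ?_
          calc Φ (octoFst ω) * Ψ (octoSnd ω) = Φ (octoFst ω) * Ψ (octoSnd ω) *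
                (multiSplitInd Ein Eout U Y ω + splitFailInd Ein Eout U Y ω) := by
                rw [multiSplitInd_add_splitFailInd, mul_one]
            _ = Φ (octoFst ω) * Ψ (octoSnd ω) * multiSplitInd Ein Eout U Y ω +
                Φ (octoFst ω) * Ψ (octoSnd ω) * splitFailInd Ein Eout U Y ω := mul_add _ _ _
            _ ≤ Φ (octoFst ω) * Ψ (octoSnd ω) * multiSplitInd Ein Eout U Y ω + 1 * splitFailInd Ein Eout U Y ω :=
                add_le_add le_rfl (mul_le_mul' (hΦΨ1' ω) le_rfl)
            _ = _ := by rw [one_mul]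
      _ ≤ _ := by
          rw [← hsw]
          refine add_le_add (ENNReal.tsum_le_tsum fun ω => mul_le_mul' le_rfl ?_) le_rfl
          calc Φ (octoFst ω) * Ψ (octoFst ω) * multiConnInd X U ω * multiSplitInd Ein Eout U Y ω
              ≤ Φ (octoFst ω) * Ψ (octoFst ω) * multiConnInd X U ω * 1 :=
                mul_le_mul' le_rfl (multiSplitInd_le_one _ _ _ _ _)
            _ = _ := mul_one _

/-! #### The variable `𝐍 = 𝐍₁𝐍₂` on the eight currents -/

/-- **`𝐍 = 𝐍₁ · 𝐍₂`** for the two sourced pairs (pairs `1` and `3` of the eight currents).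
[cite: AizenmanDuminilCopinAnnals2021, arXiv:1912.07973 §6.2, "Define 𝐍 := ∏ᵢ 𝐍ᵢ" (p. 23)] -/
def nVar (x₁ x₂ : V) (c₁ c₂ : V → ℝ≥0∞) (ω : OctoCfg G) : ℝ≥0∞ :=
  nPair x₁ c₁ ((ω 1).1 + (ω 1).2) * nPair x₂ c₂ ((ω 3).1 + (ω 3).2)

/-- `𝐍` as a weighted sum of connection indicators over the pairs of switch points:
`𝐍(ω) = ∑_{v₁,v₂} c₁(v₁)c₂(v₂) 𝟙[v₁ ↔ x₁ in n₂+n'₂] 𝟙[v₂ ↔ x₂ in n₄+n'₄]`. [folklore] -/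
theorem nVar_eq_sum (w x₁ x₂ : V) (c₁ c₂ : V → ℝ≥0∞) (ω : OctoCfg G) :
    nVar x₁ x₂ c₁ c₂ ω = ∑ v₁, ∑ v₂, c₁ v₁ * c₂ v₂ * multiConnInd (octoX w x₁ x₂) (octoU w v₁ v₂) ω := by
  unfold nVar nPair
  rw [Finset.sum_mul_sum]
  refine Finset.sum_congr rfl fun v₁ _ => Finset.sum_congr rfl fun v₂ _ => ?_
  unfold multiConnInd
  simp only [Fin.prod_univ_four, octoX, octoU, Matrix.cons_val_zero, Matrix.cons_val_one, Matrix.cons_val,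
    mem_cluster_self, if_true]
  ring

/-- `𝐍` is finite for finite coefficients. [folklore] -/
theorem nVar_ne_top {x₁ x₂ : V} {c₁ c₂ : V → ℝ≥0∞} (h₁ : ∀ v, c₁ v ≠ ∞) (h₂ : ∀ v, c₂ v ≠ ∞) (ω : OctoCfg G) :
    nVar x₁ x₂ c₁ c₂ ω ≠ ∞ :=
  ENNReal.mul_ne_top (nPair_ne_top h₁ _) (nPair_ne_top h₂ _)

/-- The weighted total switched mass is the base normalisation when the coefficients have mean one:
`∑_{v₁,v₂} c₁(v₁)c₂(v₂) ∑ W_sw(v) = srcNrm · Z[∅]⁴` ("the sum on `(u₁,…,u_t)` of `δ(u,x,y)` is `1`").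
[cite: AizenmanDuminilCopinAnnals2021, arXiv:1912.07973 §6.2, "observing that the sum on (u₁,…,u_t) of δ(u,x,y) is 1" (p. 25)] -/
theorem sum_mul_tsum_octoWeightSw (K : G.edgeFinset → ℝ) (w x₁ x₂ y₁ y₂ : V) {c₁ c₂ : V → ℝ≥0∞}
    (hc₁ : ∑ v, c₁ v * (ecurrentSum K ({x₁} ∆ {v}) * ecurrentSum K ({v} ∆ {y₁})) =
      ecurrentSum K ({x₁} ∆ {y₁}) * ecurrentSum K ∅)
    (hc₂ : ∑ v, c₂ v * (ecurrentSum K ({x₂} ∆ {v}) * ecurrentSum K ({v} ∆ {y₂})) =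
      ecurrentSum K ({x₂} ∆ {y₂}) * ecurrentSum K ∅) :
    ∑ v₁, ∑ v₂, c₁ v₁ * c₂ v₂ * ∑' ω : OctoCfg G, octoWeightSw K w x₁ x₂ y₁ y₂ v₁ v₂ ω =
      srcNrm K ({x₁} ∆ {y₁}) ({x₂} ∆ {y₂}) * ecurrentSum K ∅ ^ 4 := by
  simp_rw [tsum_octoWeightSw]
  calc ∑ v₁, ∑ v₂, c₁ v₁ * c₂ v₂ * (ecurrentSum K ∅ ^ 4 * (ecurrentSum K ({x₁} ∆ {v₁}) * ecurrentSum K ({v₁} ∆ {y₁})) *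
        (ecurrentSum K ({x₂} ∆ {v₂}) * ecurrentSum K ({v₂} ∆ {y₂})))
      = ∑ v₁, ∑ v₂, ecurrentSum K ∅ ^ 4 * ((c₁ v₁ * (ecurrentSum K ({x₁} ∆ {v₁}) * ecurrentSum K ({v₁} ∆ {y₁}))) *
          (c₂ v₂ * (ecurrentSum K ({x₂} ∆ {v₂}) * ecurrentSum K ({v₂} ∆ {y₂})))) :=
        Finset.sum_congr rfl fun v₁ _ => Finset.sum_congr rfl fun v₂ _ => by ring
    _ = ecurrentSum K ∅ ^ 4 * ∑ v₁, ∑ v₂, (c₁ v₁ * (ecurrentSum K ({x₁} ∆ {v₁}) * ecurrentSum K ({v₁} ∆ {y₁}))) *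
          (c₂ v₂ * (ecurrentSum K ({x₂} ∆ {v₂}) * ecurrentSum K ({v₂} ∆ {y₂}))) := by
        simp_rw [Finset.mul_sum]
    _ = ecurrentSum K ∅ ^ 4 * ((∑ v₁, c₁ v₁ * (ecurrentSum K ({x₁} ∆ {v₁}) * ecurrentSum K ({v₁} ∆ {y₁}))) *
          ∑ v₂, c₂ v₂ * (ecurrentSum K ({x₂} ∆ {v₂}) * ecurrentSum K ({v₂} ∆ {y₂}))) := by
        rw [Finset.sum_mul_sum]
    _ = _ := by
        rw [hc₁, hc₂]
        unfold srcNrm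
        ring

/-- **`E[𝐍] = 1`**, un-normalised: `∑ W₀ 𝐍 = srcNrm · Z[∅]⁴`. [cite: AizenmanDuminilCopinAnnals2021, arXiv:1912.07973 §6.2, proof of Prop. 6.6 ("E^{xy,∅}[𝐍ᵢ] = 1", p. 23)] -/
theorem tsum_octoWeight_mul_nVar (hK : ∀ e, 0 ≤ K e) (w x₁ x₂ y₁ y₂ : V) {c₁ c₂ : V → ℝ≥0∞}
    (hc₁ : ∑ v, c₁ v * (ecurrentSum K ({x₁} ∆ {v}) * ecurrentSum K ({v} ∆ {y₁})) =
      ecurrentSum K ({x₁} ∆ {y₁}) * ecurrentSum K ∅)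
    (hc₂ : ∑ v, c₂ v * (ecurrentSum K ({x₂} ∆ {v}) * ecurrentSum K ({v} ∆ {y₂})) =
      ecurrentSum K ({x₂} ∆ {y₂}) * ecurrentSum K ∅) :
    ∑' ω : OctoCfg G, octoWeight K w x₁ x₂ y₁ y₂ ω * nVar x₁ x₂ c₁ c₂ ω =
      srcNrm K ({x₁} ∆ {y₁}) ({x₂} ∆ {y₂}) * ecurrentSum K ∅ ^ 4 := by
  simp_rw [nVar_eq_sum w x₁ x₂ c₁ c₂, Finset.mul_sum]
  rw [Summable.tsum_finsetSum (fun _ _ => ENNReal.summable)]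
  simp_rw [Summable.tsum_finsetSum (fun _ _ => ENNReal.summable)]
  have h : ∀ v₁ v₂ (ω : OctoCfg G), octoWeight K w x₁ x₂ y₁ y₂ ω * (c₁ v₁ * c₂ v₂ *
      multiConnInd (octoX w x₁ x₂) (octoU w v₁ v₂) ω) =
      c₁ v₁ * c₂ v₂ * (octoWeight K w x₁ x₂ y₁ y₂ ω * multiConnInd (octoX w x₁ x₂) (octoU w v₁ v₂) ω) :=
    fun v₁ v₂ ω => by ring
  simp_rw [h, ENNReal.tsum_mul_left, tsum_octoWeight_mul_multiConnInd hK]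
  exact sum_mul_tsum_octoWeightSw K w x₁ x₂ y₁ y₂ hc₁ hc₂

/-- The total base mass `∑ W₀ = srcNrm · Z[∅]⁴`. [folklore] -/
theorem tsum_octoWeight (K : G.edgeFinset → ℝ) (w x₁ x₂ y₁ y₂ : V) :
    ∑' ω : OctoCfg G, octoWeight K w x₁ x₂ y₁ y₂ ω = srcNrm K ({x₁} ∆ {y₁}) ({x₂} ∆ {y₂}) * ecurrentSum K ∅ ^ 4 := by
  have h := tsum_octoWeight_mul_fst K w x₁ x₂ y₁ y₂ (fun _ => 1)
  simp only [mul_one] at h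
  rw [h, srcMass_one]

/-- **`E[𝐍²]` factorises over the two sourced pairs**: `∑ W₀ 𝐍² = Z[∅]⁴ · M₁ · M₂` with
`Mᵢ = ∑ 1{∂n={xᵢ}Δ{yᵢ}}1{∂n'=∅} w w 𝐍ᵢ(n+n')²` ("by the currents' independence").
[cite: AizenmanDuminilCopinAnnals2021, arXiv:1912.07973 §6.2, proof of Prop. 6.6 ("the currents' independence", p. 23)] -/
theorem tsum_octoWeight_mul_nVar_sq (K : G.edgeFinset → ℝ) (w x₁ x₂ y₁ y₂ : V) (c₁ c₂ : V → ℝ≥0∞) :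
    ∑' ω : OctoCfg G, octoWeight K w x₁ x₂ y₁ y₂ ω * nVar x₁ x₂ c₁ c₂ ω ^ 2 =
      ecurrentSum K ∅ ^ 4 *
        ((∑' p : Current G × Current G, epairWeight K ({x₁} ∆ {y₁}) ∅ p * nPair x₁ c₁ (p.1 + p.2) ^ 2) *
          ∑' p : Current G × Current G, epairWeight K ({x₂} ∆ {y₂}) ∅ p * nPair x₂ c₂ (p.1 + p.2) ^ 2) := by
  set g : Fin 4 → (Current G × Current G → ℝ≥0∞) :=
    ![fun p => epairWeight K ∅ ∅ p,
      fun p => epairWeight K ({x₁} ∆ {y₁}) ∅ p * nPair x₁ c₁ (p.1 + p.2) ^ 2,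
      fun p => epairWeight K ∅ ∅ p,
      fun p => epairWeight K ({x₂} ∆ {y₂}) ∅ p * nPair x₂ c₂ (p.1 + p.2) ^ 2] with hg
  have hpt : ∀ ω : OctoCfg G, octoWeight K w x₁ x₂ y₁ y₂ ω * nVar x₁ x₂ c₁ c₂ ω ^ 2 = ∏ i, g i (ω i) := by
    intro ω
    unfold octoWeight multiPairWeight nVar
    simp only [Fin.prod_univ_four, hg, Matrix.cons_val_zero, Matrix.cons_val_one, Matrix.cons_val, octoX, octoY,
      symmDiff_self, Finset.bot_eq_empty]
    ring
  simp_rw [hpt]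
  rw [tsum_pi_fin_prod 4 g]
  simp only [Fin.prod_univ_four, hg, Matrix.cons_val_zero, Matrix.cons_val_one, Matrix.cons_val, tsum_epairWeight]
  ring

/-- **The concentration of `𝐍` from the second-moment bounds** (Prop. 6.6 from (6.5)): if
`Z[∅]·Mᵢ ≤ qᵢ Z[xᵢyᵢ]Z[∅]²` for the two sourced pairs (`hB`), the coefficients have mean one (`hc`) and
`q₁q₂ ≤ 1 + ρ²`, then `∑ W₀ |𝐍-1|² ≤ ρ² · srcNrm · Z[∅]⁴` ("`E[(𝐍-1)²] = E[𝐍²] - 1`").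
[cite: AizenmanDuminilCopinAnnals2021, arXiv:1912.07973 §6.2, Prop. 6.6 and its proof (p. 23)] -/
theorem tsum_octoWeight_mul_devOne_sq_le (hK : ∀ e, 0 ≤ K e) (w x₁ x₂ y₁ y₂ : V) {c₁ c₂ : V → ℝ≥0∞}
    (h₁ : ∀ v, c₁ v ≠ ∞) (h₂ : ∀ v, c₂ v ≠ ∞)
    (hc₁ : ∑ v, c₁ v * (ecurrentSum K ({x₁} ∆ {v}) * ecurrentSum K ({v} ∆ {y₁})) =
      ecurrentSum K ({x₁} ∆ {y₁}) * ecurrentSum K ∅)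
    (hc₂ : ∑ v, c₂ v * (ecurrentSum K ({x₂} ∆ {v}) * ecurrentSum K ({v} ∆ {y₂})) =
      ecurrentSum K ({x₂} ∆ {y₂}) * ecurrentSum K ∅)
    {q₁ q₂ ρ : ℝ≥0∞}
    (hB₁ : ecurrentSum K ∅ * ∑' p : Current G × Current G, epairWeight K ({x₁} ∆ {y₁}) ∅ p * nPair x₁ c₁ (p.1 + p.2) ^ 2 ≤
      q₁ * (ecurrentSum K ({x₁} ∆ {y₁}) * ecurrentSum K ∅ ^ 2))
    (hB₂ : ecurrentSum K ∅ * ∑' p : Current G × Current G, epairWeight K ({x₂} ∆ {y₂}) ∅ p * nPair x₂ c₂ (p.1 + p.2) ^ 2 ≤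
      q₂ * (ecurrentSum K ({x₂} ∆ {y₂}) * ecurrentSum K ∅ ^ 2))
    (hρ : q₁ * q₂ ≤ 1 + ρ ^ 2) :
    ∑' ω : OctoCfg G, octoWeight K w x₁ x₂ y₁ y₂ ω * devOne (nVar x₁ x₂ c₁ c₂ ω) ^ 2 ≤
      ρ ^ 2 * (srcNrm K ({x₁} ∆ {y₁}) ({x₂} ∆ {y₂}) * ecurrentSum K ∅ ^ 4) := by
  have hZtop : ∀ A, ecurrentSum K A ≠ ∞ := fun A => ecurrentSum_ne_top hK A
  have hZ0 : ecurrentSum K (∅ : Finset V) ≠ 0 := ecurrentSum_empty_ne_zero K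
  set N8 : ℝ≥0∞ := srcNrm K ({x₁} ∆ {y₁}) ({x₂} ∆ {y₂}) * ecurrentSum K ∅ ^ 4 with hN8
  have hN8top : N8 ≠ ∞ := by
    rw [hN8]; unfold srcNrm
    exact ENNReal.mul_ne_top (ENNReal.mul_ne_top (ENNReal.mul_ne_top (hZtop _) (hZtop _))
      (ENNReal.mul_ne_top (hZtop _) (hZtop _))) (ENNReal.pow_ne_top (hZtop _))
  -- `∑ W₀ 𝐍² ≤ q₁q₂ N8`
  have hsq : ∑' ω : OctoCfg G, octoWeight K w x₁ x₂ y₁ y₂ ω * nVar x₁ x₂ c₁ c₂ ω ^ 2 ≤ q₁ * q₂ * N8 := by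
    rw [tsum_octoWeight_mul_nVar_sq]
    -- cancel one `Z[∅]` in each second-moment bound
    have hM₁ : ecurrentSum K ∅ * ∑' p : Current G × Current G, epairWeight K ({x₁} ∆ {y₁}) ∅ p * nPair x₁ c₁ (p.1 + p.2) ^ 2 ≤
        ecurrentSum K ∅ * (q₁ * (ecurrentSum K ({x₁} ∆ {y₁}) * ecurrentSum K ∅)) :=
      hB₁.trans (le_of_eq (by ring))
    have hM₂ : ecurrentSum K ∅ * ∑' p : Current G × Current G, epairWeight K ({x₂} ∆ {y₂}) ∅ p * nPair x₂ c₂ (p.1 + p.2) ^ 2 ≤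
        ecurrentSum K ∅ * (q₂ * (ecurrentSum K ({x₂} ∆ {y₂}) * ecurrentSum K ∅)) :=
      hB₂.trans (le_of_eq (by ring))
    have hM₁' := (ENNReal.mul_le_mul_iff_right hZ0 (hZtop ∅)).1 hM₁
    have hM₂' := (ENNReal.mul_le_mul_iff_right hZ0 (hZtop ∅)).1 hM₂
    calc ecurrentSum K ∅ ^ 4 *
          ((∑' p : Current G × Current G, epairWeight K ({x₁} ∆ {y₁}) ∅ p * nPair x₁ c₁ (p.1 + p.2) ^ 2) *
            ∑' p : Current G × Current G, epairWeight K ({x₂} ∆ {y₂}) ∅ p * nPair x₂ c₂ (p.1 + p.2) ^ 2)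
        ≤ ecurrentSum K ∅ ^ 4 * ((q₁ * (ecurrentSum K ({x₁} ∆ {y₁}) * ecurrentSum K ∅)) *
            (q₂ * (ecurrentSum K ({x₂} ∆ {y₂}) * ecurrentSum K ∅))) :=
          mul_le_mul' le_rfl (mul_le_mul' hM₁' hM₂')
      _ = q₁ * q₂ * N8 := by rw [hN8]; unfold srcNrm; ring
  -- the variance identity integrated
  have hid : ∑' ω : OctoCfg G, octoWeight K w x₁ x₂ y₁ y₂ ω * nVar x₁ x₂ c₁ c₂ ω ^ 2 + N8 =
      ∑' ω : OctoCfg G, octoWeight K w x₁ x₂ y₁ y₂ ω * devOne (nVar x₁ x₂ c₁ c₂ ω) ^ 2 + 2 * N8 := by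
    have hmean := tsum_octoWeight_mul_nVar hK w x₁ x₂ y₁ y₂ hc₁ hc₂
    have htot := tsum_octoWeight K w x₁ x₂ y₁ y₂
    rw [← hN8] at hmean htot
    calc ∑' ω : OctoCfg G, octoWeight K w x₁ x₂ y₁ y₂ ω * nVar x₁ x₂ c₁ c₂ ω ^ 2 + N8
        = ∑' ω : OctoCfg G, octoWeight K w x₁ x₂ y₁ y₂ ω * (nVar x₁ x₂ c₁ c₂ ω ^ 2 + 1) := by
          rw [← htot, ← ENNReal.tsum_add]
          exact tsum_congr fun ω => by ring
      _ = ∑' ω : OctoCfg G, octoWeight K w x₁ x₂ y₁ y₂ ω * (devOne (nVar x₁ x₂ c₁ c₂ ω) ^ 2 + 2 * nVar x₁ x₂ c₁ c₂ ω) :=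
          tsum_congr fun ω => by rw [sq_add_one_eq_devOne_sq_add (nVar_ne_top h₁ h₂ ω)]
      _ = ∑' ω : OctoCfg G, octoWeight K w x₁ x₂ y₁ y₂ ω * devOne (nVar x₁ x₂ c₁ c₂ ω) ^ 2 +
          2 * ∑' ω : OctoCfg G, octoWeight K w x₁ x₂ y₁ y₂ ω * nVar x₁ x₂ c₁ c₂ ω := by
          rw [← ENNReal.tsum_mul_left, ← ENNReal.tsum_add]
          exact tsum_congr fun ω => by ring
      _ = _ := by rw [hmean]
  -- conclude: `D + 2N8 = S + N8 ≤ q₁q₂N8 + N8 ≤ (1+ρ²)N8 + N8 = ρ²N8 + 2N8`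
  have h2N8 : 2 * N8 ≠ ∞ := ENNReal.mul_ne_top ENNReal.ofNat_ne_top hN8top
  refine (ENNReal.add_le_add_iff_right h2N8).1 ?_
  calc ∑' ω : OctoCfg G, octoWeight K w x₁ x₂ y₁ y₂ ω * devOne (nVar x₁ x₂ c₁ c₂ ω) ^ 2 + 2 * N8
      = ∑' ω : OctoCfg G, octoWeight K w x₁ x₂ y₁ y₂ ω * nVar x₁ x₂ c₁ c₂ ω ^ 2 + N8 := hid.symm
    _ ≤ q₁ * q₂ * N8 + N8 := add_le_add hsq le_rfl
    _ ≤ (1 + ρ ^ 2) * N8 + N8 := add_le_add (mul_le_mul' hρ le_rfl) le_rfl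
    _ = ρ ^ 2 * N8 + 2 * N8 := by ring

/-- **"`|P[E ∩ F] - E[𝐍𝕀_{E∩F}]| ≤ √E[(𝐍-1)²]`", un-normalised** (Cauchy–Schwarz): for `Θ ≤ 1`, under
the hypotheses of `tsum_octoWeight_mul_devOne_sq_le`,
`∑ W₀ Θ(n) |𝐍-1| ≤ ρ · srcNrm · Z[∅]⁴`. [cite: AizenmanDuminilCopinAnnals2021, arXiv:1912.07973 §6.2, the display "Applying the Cauchy–Schwarz inequality gives …" (p. 24)] -/
theorem tsum_octoWeight_mul_mul_devOne_le (hK : ∀ e, 0 ≤ K e) (w x₁ x₂ y₁ y₂ : V) {c₁ c₂ : V → ℝ≥0∞}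
    (h₁ : ∀ v, c₁ v ≠ ∞) (h₂ : ∀ v, c₂ v ≠ ∞)
    (hc₁ : ∑ v, c₁ v * (ecurrentSum K ({x₁} ∆ {v}) * ecurrentSum K ({v} ∆ {y₁})) =
      ecurrentSum K ({x₁} ∆ {y₁}) * ecurrentSum K ∅)
    (hc₂ : ∑ v, c₂ v * (ecurrentSum K ({x₂} ∆ {v}) * ecurrentSum K ({v} ∆ {y₂})) =
      ecurrentSum K ({x₂} ∆ {y₂}) * ecurrentSum K ∅)
    {q₁ q₂ ρ : ℝ≥0∞}
    (hB₁ : ecurrentSum K ∅ * ∑' p : Current G × Current G, epairWeight K ({x₁} ∆ {y₁}) ∅ p * nPair x₁ c₁ (p.1 + p.2) ^ 2 ≤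
      q₁ * (ecurrentSum K ({x₁} ∆ {y₁}) * ecurrentSum K ∅ ^ 2))
    (hB₂ : ecurrentSum K ∅ * ∑' p : Current G × Current G, epairWeight K ({x₂} ∆ {y₂}) ∅ p * nPair x₂ c₂ (p.1 + p.2) ^ 2 ≤
      q₂ * (ecurrentSum K ({x₂} ∆ {y₂}) * ecurrentSum K ∅ ^ 2))
    (hρ : q₁ * q₂ ≤ 1 + ρ ^ 2) {Θ : FourCfg G → ℝ≥0∞} (hΘ : ∀ pq, Θ pq ≤ 1) :
    ∑' ω : OctoCfg G, octoWeight K w x₁ x₂ y₁ y₂ ω * (Θ (octoFst ω) * devOne (nVar x₁ x₂ c₁ c₂ ω)) ≤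
      ρ * (srcNrm K ({x₁} ∆ {y₁}) ({x₂} ∆ {y₂}) * ecurrentSum K ∅ ^ 4) := by
  set N8 : ℝ≥0∞ := srcNrm K ({x₁} ∆ {y₁}) ({x₂} ∆ {y₂}) * ecurrentSum K ∅ ^ 4 with hN8
  have hD := tsum_octoWeight_mul_devOne_sq_le hK w x₁ x₂ y₁ y₂ h₁ h₂ hc₁ hc₂ hB₁ hB₂ hρ
  have htot := tsum_octoWeight K w x₁ x₂ y₁ y₂
  rw [← hN8] at hD htot
  -- Cauchy–Schwarz with the weight `W₀ Θ`, `f = |𝐍-1|`, `g = 1`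
  have hCS := tsum_mul_mul_sq_le (fun ω : OctoCfg G => octoWeight K w x₁ x₂ y₁ y₂ ω * Θ (octoFst ω))
    (fun ω => devOne (nVar x₁ x₂ c₁ c₂ ω)) (fun _ => 1)
  simp only [mul_one, one_pow] at hCS
  have hsq : (∑' ω : OctoCfg G, octoWeight K w x₁ x₂ y₁ y₂ ω * (Θ (octoFst ω) * devOne (nVar x₁ x₂ c₁ c₂ ω))) ^ 2 ≤
      (ρ * N8) ^ 2 :=
    calc _ = (∑' ω : OctoCfg G, octoWeight K w x₁ x₂ y₁ y₂ ω * Θ (octoFst ω) * devOne (nVar x₁ x₂ c₁ c₂ ω)) ^ 2 := by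
          congr 1; exact tsum_congr fun ω => by ring
      _ ≤ (∑' ω : OctoCfg G, octoWeight K w x₁ x₂ y₁ y₂ ω * Θ (octoFst ω) * devOne (nVar x₁ x₂ c₁ c₂ ω) ^ 2) *
            ∑' ω : OctoCfg G, octoWeight K w x₁ x₂ y₁ y₂ ω * Θ (octoFst ω) := hCS
      _ ≤ (∑' ω : OctoCfg G, octoWeight K w x₁ x₂ y₁ y₂ ω * devOne (nVar x₁ x₂ c₁ c₂ ω) ^ 2) *
            ∑' ω : OctoCfg G, octoWeight K w x₁ x₂ y₁ y₂ ω := by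
          refine mul_le_mul' (ENNReal.tsum_le_tsum fun ω => ?_) (ENNReal.tsum_le_tsum fun ω => ?_)
          · calc octoWeight K w x₁ x₂ y₁ y₂ ω * Θ (octoFst ω) * devOne (nVar x₁ x₂ c₁ c₂ ω) ^ 2
                ≤ octoWeight K w x₁ x₂ y₁ y₂ ω * 1 * devOne (nVar x₁ x₂ c₁ c₂ ω) ^ 2 :=
                  mul_le_mul' (mul_le_mul' le_rfl (hΘ _)) le_rfl
              _ = _ := by rw [mul_one]
          · calc octoWeight K w x₁ x₂ y₁ y₂ ω * Θ (octoFst ω) ≤ octoWeight K w x₁ x₂ y₁ y₂ ω * 1 :=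
                  mul_le_mul' le_rfl (hΘ _)
              _ = _ := mul_one _
      _ ≤ ρ ^ 2 * N8 * N8 := by rw [htot]; exact mul_le_mul' hD le_rfl
      _ = (ρ * N8) ^ 2 := by ring
  exact (ENNReal.pow_le_pow_left_iff two_ne_zero).1 hsq

/-! #### The main theorem: (6.16) -/

/-- **Aizenman–Duminil-Copin 2021, (6.16) — the approximate factorisation of the mixing argument — on a
finite graph, from its inputs.** Setting: couplings `K ≥ 0`; edge sets `E_in`, `E_out`; the measure
`P^{x₁y₁,x₂y₂,∅,∅}` (two independent double currents, `srcWeight`); non-negative finite coefficients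
`c₁, c₂` on the vertices (printed: `c_i(u) = 1/(|𝒦| A_{x_i,y_i}(2^k))` on `𝔸_{y_i}(2^k)`, `k ∈ 𝒦`) with
**mean one** (`hc`: `∑_u c_i(u)⟨σ_{x_i}σ_u⟩⟨σ_uσ_{y_i}⟩ = ⟨σ_{x_i}σ_{y_i}⟩`, i.e. `E[𝐍ᵢ] = 1`);
HYPOTHESES: the **second-moment bounds** `hB` (`E^{x_iy_i,∅}[𝐍ᵢ²] ≤ qᵢ`, un-normalised through Prop. A.3
— the content of (6.5)) with `q₁q₂ ≤ 1 + ρ²` (printed: `qᵢ = 1 + C₂/|𝒦|`, `ρ² ≍ 1/|𝒦| ≍ 1/log(N/n)`),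
and the **split-event bound** `hG` (Lemma 6.7: `P^{xu,uy}[G(u)ᶜ] ≤ ε_G` for all switch points in the
support of the coefficients). CONCLUSION, for `Φ ≤ 1` local on `E_in` and `Ψ ≤ 1` local on `E_out`
(`Current.FourLocal`), writing `M^{A}[·] = srcMass K A₁ A₂ ·`:
`|M^{xy}[ΦΨ]·Z[∅]⁴ - ∑_{u₁,u₂} c₁(u₁)c₂(u₂) M^{xu}[Φ] M^{uy}[Ψ]| ≤ (ρ + ε_G) · srcNrm · Z[∅]⁴`
(both one-sided inequalities), which after division by `srcNrm·Z[∅]⁴` is the printed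
"`|P^{xy}[E∩F] - ∑_u δ(u,x,y) P^{xu}[E]P^{uy}[F]| ≤ C₅s/√log(N/n) + 2C₆s(n/N)^ε`" with
`δ(u) = c₁(u₁)c₂(u₂)a_{x₁,y₁}(u₁)a_{x₂,y₂}(u₂)`. Proof as printed: Cauchy–Schwarz with `E[(𝐍-1)²]`
(`tsum_octoWeight_mul_mul_devOne_le`), the localized switching (6.14) and the independence (6.15) for
each pair of switch points (`tsum_octoWeight_conn_le_and_ge`), Lemma 6.7, and `∑_u δ = 1`.
[cite: AizenmanDuminilCopinAnnals2021, arXiv:1912.07973 §6.2, (6.16) and its derivation (pp. 23–25); Panis2023Triviality, arXiv:2309.05797 §6.4, (6.10)] -/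
theorem mixingCore (hK : ∀ e, 0 ≤ K e) (Ein Eout : Finset G.edgeFinset) (w x₁ x₂ y₁ y₂ : V)
    {c₁ c₂ : V → ℝ≥0∞} (h₁ : ∀ v, c₁ v ≠ ∞) (h₂ : ∀ v, c₂ v ≠ ∞)
    (hc₁ : ∑ v, c₁ v * (ecurrentSum K ({x₁} ∆ {v}) * ecurrentSum K ({v} ∆ {y₁})) =
      ecurrentSum K ({x₁} ∆ {y₁}) * ecurrentSum K ∅)
    (hc₂ : ∑ v, c₂ v * (ecurrentSum K ({x₂} ∆ {v}) * ecurrentSum K ({v} ∆ {y₂})) =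
      ecurrentSum K ({x₂} ∆ {y₂}) * ecurrentSum K ∅)
    {q₁ q₂ ρ εG : ℝ≥0∞}
    (hB₁ : ecurrentSum K ∅ * ∑' p : Current G × Current G, epairWeight K ({x₁} ∆ {y₁}) ∅ p * nPair x₁ c₁ (p.1 + p.2) ^ 2 ≤
      q₁ * (ecurrentSum K ({x₁} ∆ {y₁}) * ecurrentSum K ∅ ^ 2))
    (hB₂ : ecurrentSum K ∅ * ∑' p : Current G × Current G, epairWeight K ({x₂} ∆ {y₂}) ∅ p * nPair x₂ c₂ (p.1 + p.2) ^ 2 ≤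
      q₂ * (ecurrentSum K ({x₂} ∆ {y₂}) * ecurrentSum K ∅ ^ 2))
    (hρ : q₁ * q₂ ≤ 1 + ρ ^ 2)
    (hG : ∀ v₁ v₂, c₁ v₁ ≠ 0 → c₂ v₂ ≠ 0 →
      ∑' ω : OctoCfg G, octoWeightSw K w x₁ x₂ y₁ y₂ v₁ v₂ ω * splitFailInd Ein Eout (octoU w v₁ v₂) (octoY w y₁ y₂) ω ≤
        εG * ∑' ω : OctoCfg G, octoWeightSw K w x₁ x₂ y₁ y₂ v₁ v₂ ω)
    {Φ Ψ : FourCfg G → ℝ≥0∞} (hΦ1 : ∀ pq, Φ pq ≤ 1) (hΨ1 : ∀ pq, Ψ pq ≤ 1)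
    (hΦ : FourLocal Ein Φ) (hΨ : FourLocal Eout Ψ) :
    (srcMass K ({x₁} ∆ {y₁}) ({x₂} ∆ {y₂}) (Φ * Ψ) * ecurrentSum K ∅ ^ 4 ≤
      (∑ v₁, ∑ v₂, c₁ v₁ * c₂ v₂ *
        (srcMass K ({x₁} ∆ {v₁}) ({x₂} ∆ {v₂}) Φ * srcMass K ({v₁} ∆ {y₁}) ({v₂} ∆ {y₂}) Ψ)) +
        (ρ + εG) * (srcNrm K ({x₁} ∆ {y₁}) ({x₂} ∆ {y₂}) * ecurrentSum K ∅ ^ 4)) ∧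
    ((∑ v₁, ∑ v₂, c₁ v₁ * c₂ v₂ *
        (srcMass K ({x₁} ∆ {v₁}) ({x₂} ∆ {v₂}) Φ * srcMass K ({v₁} ∆ {y₁}) ({v₂} ∆ {y₂}) Ψ)) ≤
      srcMass K ({x₁} ∆ {y₁}) ({x₂} ∆ {y₂}) (Φ * Ψ) * ecurrentSum K ∅ ^ 4 +
        (ρ + εG) * (srcNrm K ({x₁} ∆ {y₁}) ({x₂} ∆ {y₂}) * ecurrentSum K ∅ ^ 4)) := by
  set N8 : ℝ≥0∞ := srcNrm K ({x₁} ∆ {y₁}) ({x₂} ∆ {y₂}) * ecurrentSum K ∅ ^ 4 with hN8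
  set X := octoX w x₁ x₂ with hX
  set Y := octoY w y₁ y₂ with hY
  set W₀ : OctoCfg G → ℝ≥0∞ := octoWeight K w x₁ x₂ y₁ y₂ with hW₀
  -- the per-switch-point quantities
  set T : V → V → ℝ≥0∞ := fun v₁ v₂ => ∑' ω : OctoCfg G, W₀ ω *
    (Φ (octoFst ω) * Ψ (octoFst ω) * multiConnInd X (octoU w v₁ v₂) ω) with hT
  set M : V → V → ℝ≥0∞ := fun v₁ v₂ =>
    srcMass K ({x₁} ∆ {v₁}) ({x₂} ∆ {v₂}) Φ * srcMass K ({v₁} ∆ {y₁}) ({v₂} ∆ {y₂}) Ψ with hM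
  set R : V → V → ℝ≥0∞ := fun v₁ v₂ => ∑' ω : OctoCfg G, octoWeightSw K w x₁ x₂ y₁ y₂ v₁ v₂ ω *
    splitFailInd Ein Eout (octoU w v₁ v₂) Y ω with hR
  have hTM : ∀ v₁ v₂, T v₁ v₂ ≤ M v₁ v₂ + R v₁ v₂ ∧ M v₁ v₂ ≤ T v₁ v₂ + R v₁ v₂ := fun v₁ v₂ =>
    tsum_octoWeight_conn_le_and_ge hK Ein Eout w x₁ x₂ y₁ y₂ v₁ v₂ hΦ1 hΨ1 hΦ hΨ
  -- `∑ cc R ≤ εG N8`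
  have hRsum : ∑ v₁, ∑ v₂, c₁ v₁ * c₂ v₂ * R v₁ v₂ ≤ εG * N8 := by
    calc ∑ v₁, ∑ v₂, c₁ v₁ * c₂ v₂ * R v₁ v₂
        ≤ ∑ v₁, ∑ v₂, c₁ v₁ * c₂ v₂ * (εG * ∑' ω : OctoCfg G, octoWeightSw K w x₁ x₂ y₁ y₂ v₁ v₂ ω) := by
          refine Finset.sum_le_sum fun v₁ _ => Finset.sum_le_sum fun v₂ _ => ?_
          by_cases hc1 : c₁ v₁ = 0
          · simp [hc1]
          by_cases hc2 : c₂ v₂ = 0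
          · simp [hc2]
          exact mul_le_mul' le_rfl (hG v₁ v₂ hc1 hc2)
      _ = εG * ∑ v₁, ∑ v₂, c₁ v₁ * c₂ v₂ * ∑' ω : OctoCfg G, octoWeightSw K w x₁ x₂ y₁ y₂ v₁ v₂ ω := by
          simp_rw [Finset.mul_sum]
          exact Finset.sum_congr rfl fun v₁ _ => Finset.sum_congr rfl fun v₂ _ => by ring
      _ = εG * N8 := by rw [sum_mul_tsum_octoWeightSw K w x₁ x₂ y₁ y₂ hc₁ hc₂]
  -- `TN := ∑ W₀ ΦΨ 𝐍 = ∑ cc T`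
  have hTN : ∑' ω : OctoCfg G, W₀ ω * (Φ (octoFst ω) * Ψ (octoFst ω) * nVar x₁ x₂ c₁ c₂ ω) =
      ∑ v₁, ∑ v₂, c₁ v₁ * c₂ v₂ * T v₁ v₂ := by
    simp_rw [hT, nVar_eq_sum w x₁ x₂ c₁ c₂, Finset.mul_sum]
    rw [Summable.tsum_finsetSum (fun _ _ => ENNReal.summable)]
    simp_rw [Summable.tsum_finsetSum (fun _ _ => ENNReal.summable)]
    refine Finset.sum_congr rfl fun v₁ _ => Finset.sum_congr rfl fun v₂ _ => ?_
    rw [← ENNReal.tsum_mul_left]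
    exact tsum_congr fun ω => by ring
  -- the deviation term and the plain mass
  have hdev := tsum_octoWeight_mul_mul_devOne_le hK w x₁ x₂ y₁ y₂ h₁ h₂ hc₁ hc₂ hB₁ hB₂ hρ
    (Θ := fun pq => Φ pq * Ψ pq) (fun pq => (mul_le_mul' (hΦ1 pq) (hΨ1 pq)).trans (le_of_eq (one_mul 1)))
  rw [← hN8] at hdev
  have hM0 : ∑' ω : OctoCfg G, W₀ ω * (Φ (octoFst ω) * Ψ (octoFst ω)) =
      srcMass K ({x₁} ∆ {y₁}) ({x₂} ∆ {y₂}) (Φ * Ψ) * ecurrentSum K ∅ ^ 4 :=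
    tsum_octoWeight_mul_fst K w x₁ x₂ y₁ y₂ (fun pq => Φ pq * Ψ pq)
  have hNfin : ∀ ω : OctoCfg G, nVar x₁ x₂ c₁ c₂ ω ≠ ∞ := nVar_ne_top h₁ h₂
  -- `M0 ≤ TN + dev` and `TN ≤ M0 + dev`
  have hup : srcMass K ({x₁} ∆ {y₁}) ({x₂} ∆ {y₂}) (Φ * Ψ) * ecurrentSum K ∅ ^ 4 ≤
      ∑ v₁, ∑ v₂, c₁ v₁ * c₂ v₂ * T v₁ v₂ + ρ * N8 := by
    rw [← hM0, ← hTN]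
    calc ∑' ω : OctoCfg G, W₀ ω * (Φ (octoFst ω) * Ψ (octoFst ω))
        ≤ ∑' ω : OctoCfg G, (W₀ ω * (Φ (octoFst ω) * Ψ (octoFst ω) * nVar x₁ x₂ c₁ c₂ ω) +
            W₀ ω * (Φ (octoFst ω) * Ψ (octoFst ω) * devOne (nVar x₁ x₂ c₁ c₂ ω))) := by
          refine ENNReal.tsum_le_tsum fun ω => ?_
          rw [← mul_add, ← mul_add]
          refine mul_le_mul' le_rfl ?_
          calc Φ (octoFst ω) * Ψ (octoFst ω) = Φ (octoFst ω) * Ψ (octoFst ω) * 1 := (mul_one _).symm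
            _ ≤ _ := mul_le_mul' le_rfl (one_le_add_devOne (hNfin ω))
      _ = _ := ENNReal.tsum_add
      _ ≤ _ := add_le_add le_rfl hdev
  have hdown : ∑ v₁, ∑ v₂, c₁ v₁ * c₂ v₂ * T v₁ v₂ ≤
      srcMass K ({x₁} ∆ {y₁}) ({x₂} ∆ {y₂}) (Φ * Ψ) * ecurrentSum K ∅ ^ 4 + ρ * N8 := by
    rw [← hM0, ← hTN]
    calc ∑' ω : OctoCfg G, W₀ ω * (Φ (octoFst ω) * Ψ (octoFst ω) * nVar x₁ x₂ c₁ c₂ ω)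
        ≤ ∑' ω : OctoCfg G, (W₀ ω * (Φ (octoFst ω) * Ψ (octoFst ω)) +
            W₀ ω * (Φ (octoFst ω) * Ψ (octoFst ω) * devOne (nVar x₁ x₂ c₁ c₂ ω))) := by
          refine ENNReal.tsum_le_tsum fun ω => ?_
          rw [← mul_add]
          refine mul_le_mul' le_rfl ?_
          calc Φ (octoFst ω) * Ψ (octoFst ω) * nVar x₁ x₂ c₁ c₂ ω
              ≤ Φ (octoFst ω) * Ψ (octoFst ω) * (1 + devOne (nVar x₁ x₂ c₁ c₂ ω)) :=
                mul_le_mul' le_rfl (le_one_add_devOne (hNfin ω))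
            _ = _ := by ring
      _ = _ := ENNReal.tsum_add
      _ ≤ _ := add_le_add le_rfl hdev
  -- `∑ cc T ≤ ∑ cc M + εG N8` and `∑ cc M ≤ ∑ cc T + εG N8`
  have hT_le : ∑ v₁, ∑ v₂, c₁ v₁ * c₂ v₂ * T v₁ v₂ ≤ ∑ v₁, ∑ v₂, c₁ v₁ * c₂ v₂ * M v₁ v₂ + εG * N8 :=
    calc ∑ v₁, ∑ v₂, c₁ v₁ * c₂ v₂ * T v₁ v₂ ≤ ∑ v₁, ∑ v₂, c₁ v₁ * c₂ v₂ * (M v₁ v₂ + R v₁ v₂) :=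
          Finset.sum_le_sum fun v₁ _ => Finset.sum_le_sum fun v₂ _ => mul_le_mul' le_rfl (hTM v₁ v₂).1
      _ = ∑ v₁, ∑ v₂, c₁ v₁ * c₂ v₂ * M v₁ v₂ + ∑ v₁, ∑ v₂, c₁ v₁ * c₂ v₂ * R v₁ v₂ := by
          rw [← Finset.sum_add_distrib]
          refine Finset.sum_congr rfl fun v₁ _ => ?_
          rw [← Finset.sum_add_distrib]
          exact Finset.sum_congr rfl fun v₂ _ => by ring
      _ ≤ _ := add_le_add le_rfl hRsum
  have hM_le : ∑ v₁, ∑ v₂, c₁ v₁ * c₂ v₂ * M v₁ v₂ ≤ ∑ v₁, ∑ v₂, c₁ v₁ * c₂ v₂ * T v₁ v₂ + εG * N8 :=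
    calc ∑ v₁, ∑ v₂, c₁ v₁ * c₂ v₂ * M v₁ v₂ ≤ ∑ v₁, ∑ v₂, c₁ v₁ * c₂ v₂ * (T v₁ v₂ + R v₁ v₂) :=
          Finset.sum_le_sum fun v₁ _ => Finset.sum_le_sum fun v₂ _ => mul_le_mul' le_rfl (hTM v₁ v₂).2
      _ = ∑ v₁, ∑ v₂, c₁ v₁ * c₂ v₂ * T v₁ v₂ + ∑ v₁, ∑ v₂, c₁ v₁ * c₂ v₂ * R v₁ v₂ := by
          rw [← Finset.sum_add_distrib]
          refine Finset.sum_congr rfl fun v₁ _ => ?_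
          rw [← Finset.sum_add_distrib]
          exact Finset.sum_congr rfl fun v₂ _ => by ring
      _ ≤ _ := add_le_add le_rfl hRsum
  constructor
  · calc srcMass K ({x₁} ∆ {y₁}) ({x₂} ∆ {y₂}) (Φ * Ψ) * ecurrentSum K ∅ ^ 4
        ≤ ∑ v₁, ∑ v₂, c₁ v₁ * c₂ v₂ * T v₁ v₂ + ρ * N8 := hup
      _ ≤ ∑ v₁, ∑ v₂, c₁ v₁ * c₂ v₂ * M v₁ v₂ + εG * N8 + ρ * N8 := add_le_add hT_le le_rfl
      _ = _ := by rw [hM]; ring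
  · calc ∑ v₁, ∑ v₂, c₁ v₁ * c₂ v₂ * M v₁ v₂
        ≤ ∑ v₁, ∑ v₂, c₁ v₁ * c₂ v₂ * T v₁ v₂ + εG * N8 := hM_le
      _ ≤ srcMass K ({x₁} ∆ {y₁}) ({x₂} ∆ {y₂}) (Φ * Ψ) * ecurrentSum K ∅ ^ 4 + ρ * N8 + εG * N8 :=
          add_le_add hdown le_rfl
      _ = _ := by ring

end Current

end Literature.Probability.LatticeModels
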